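/-
Copyright (c) 2026 the pub-hodgecm-mathlib formalisation cell (harness21).  Typer seat hodgecm-mathlib-TN-t02 (g3), carpet-typing squad
TN «LN ∕ LS transfer» (SEATPLAN-GO500 v1 §2; TN-plan 03:52:11Z, block B of the A∕B split with TN-t05 (g4), 2026-09-02).
-/
import Literature.NumberTheory.Automorphic.Shelstad1979.InnerFormsAndCharacters
import Literature.NumberTheory.Automorphic.Langlands1983.GroupesEndoscopiques
import Mathlib.MeasureTheory.Integral.Bochner.Basic
import Mathlib.Analysis.Complex.Polynomial.Basic
import Mathlib.Algebra.Category.Grp.Injective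
import Mathlib.Analysis.Complex.Basic
import HarnessLib

/-!
# Shelstad (1982), §2 «Endoscopic groups» and §3.2–§3.4 «Standard position, correction characters, Levi groups» —
# the numbered statements as named facts, the lattice half of (2.3)–(2.4) as REAL definitions

D. Shelstad, *L-indistinguishability for real groups*, Math. Ann. **259** (1982) 385–430 [Shelstad1982]; this file covers
§2 = pp. 389–393 ((2.1) data for endoscopic groups, Lemmas 2.1.6–2.1.7; (2.2) endoscopic groups, Definition 2.2.1, (2.2.2)–(2.2.3);
(2.3) `(T, κ)`-pairs, Propositions 2.3.1–2.3.2, Lemma 2.3.3; (2.4) elements of `H` originating in `G`, (2.4.1), Lemma 2.4.2,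
(2.4.3)–(2.4.4), Proposition 2.4.5) and §3.2–§3.4 = pp. 395–398 ((3.2) standard position (3.2.1)–(3.2.2), framework of Cartan
subgroups, Propositions 3.2.3–3.2.4; (3.3) admissible embeddings (3.3.1)–(3.3.2), correction characters (3.3.3); (3.4) Levi groups
(3.4.1), `f_M`, `Δ^M`, Proposition 3.4.2).  PAGE PINS «(p. N)» are the printed Math. Ann. pages, read on the GDZ page images
(`PPN235181684_0259`, LOG_0060; HCML cell `T/LNS/TN-t05/g4/pages-Shelstad1982/pNNNN.jpg`, file = printed page) — the GDZ OCR text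
drops the displays, every display below was read on the image.  Squad TN (HCML «GO 500»); block A (§3.1, §3.5–3.7, §4: the transfer
factors `Δ_(T,η)`, Theorem 4.1.1) is the sibling `…/Shelstad1982/TransferAndLifting.lean` (seat TN-t05 g4), which takes the §2 notions
below as binders.  Topic `NumberTheory/Automorphic/Shelstad1982`, namespace `Literature.NumberTheory.Automorphic.Shelstad1982.EndoscopicData`.
STATEMENTS (named facts `def … : Prop`) + REAL definitions + a short section `Discharges` proving the items that are formal in the
dress; no `sorry`, no `axiom`, no `instance`, no `notation`.

## The dress (read this first)
* **Group side** = the squad's real-group dictionary of ★ `Shelstad1979/InnerFormsAndCharacters`: ONE abstract group `GC` for the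
  complex group «`G`» `= G(ℂ)` with complex conjugation `σ : GC ≃* GC`, real points ★ `realPoints σ`, a maximal torus over `ℝ` = a
  `σ`-stable subgroup `TC ≤ GC` (a PARAMETER; «maximal torus» has no abstract-group model), «defined over `ℝ`» = ★ `IsDefinedOverOn`,
  `𝔄(T)` = ★ `scriptA`, the inner twist `ψ : G → G*` = `ψ : GC ≃* GsC` with `σs` on `GsC` and the distinguished torus `T* = TsC`;
  the endoscopic group `H` likewise (`HC`, `σH`, `T_H = THC`).  A pseudo-diagonalization (p. 389) `η = ad m₁ ∘ ad x₁ ∘ ψ : T → T*` is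
  the group isomorphism `pd ψ x₁ m₁ : GC ≃* GsC` READ ON `TC` (its defining conditions — `T₁` standard, `m₁ ∈ M_{T₁}` — are the
  predicate `IsPD` on explicit parameters `IsStandard`, `leviOf`).
* **Lattice side** (print, p. 389: «When transferring data from `T` to `T*` or `ᴸT⁰ “via η”` we use the induced maps `X_*(T) → X_*(T*)
  = X*(ᴸT⁰)` … without additional comment»): ONE lattice `Y` = «`X_*(T*) = X*(ᴸT⁰)`» (`[AddCommGroup Y]`), `Ysc ≤ Y` = «`X_*(T*_sc)`»
  (the coroot lattice), a pair `(T, η)` contributing the involution `σTη : Y ≃ₗ[ℤ] Y` = «`σ_{T,η}`, the transfer of `σ_T` to `ᴸT⁰` via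
  `η`» (p. 389, last line), `ᴸT⁰ = Hom(X*(ᴸT⁰), ℂ^×)` = the characters `Y →+ Additive ℂ^×` (as in ★ `Langlands1983/GroupesEndoscopiques`,
  whose `KLocal`, `augLatticeOf`, `normZeroLattice`, `racinesH` are the instance-action twins of the explicit-involution definitions
  below — cited, not restated: here the Galois involution VARIES with `(T, η)`, so it is an explicit lattice automorphism `Y ≃ₗ[ℤ] Y`, not an instance).
* **Dual side** (ᴸG⁰ with `W` acting through `𝔊 = Gal(ℂ/ℝ)`, p. 389): ONE group `Gd` = «`ᴸG⁰`» with `σd : Gd ≃* Gd` the action of the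
  non-trivial element of `𝔊`; an element `g = g₀ × (1 × σ)` of `ᴸG⁰ × (1 × σ)` acts on `ᴸG⁰` by `adSigma σd g₀ = (x ↦ g₀ σ(x) g₀⁻¹)`;
  `Z^W` = `centerW σd`.  The non-group-theoretic entries of a sextuple — «Borel subgroup», «root vectors `{Y_α∨}`», «semi-simple»,
  «`Cent(s)⁰`» — enter as explicit PARAMETERS (`IsSemisimple`, `centConn`, `IsBorelPair`) and, for `{Y_α∨}`, through the set
  `splittingAut` of automorphisms preserving `(ᴸH⁰, ᴸB⁰_H, ᴸT⁰_H, {Y_α∨})` (this is the only way print uses `{Y_α∨}`: Lemma 2.1.7,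
  equivalence of data).  `ρ_s` «factors through `W → 𝔊`» (2.1.5), so it is recorded by the single automorphism `σ_H = ρ_s(w)`, `w ↦ σ`
  (print, p. 390: «to specify `ρ_s` we need only give an automorphism `σ_H` of `ᴸH⁰` such that `σ_H² = 1` and …»).
**Every numbered item is a `def … : Prop`.**  Two kinds (squad COORDINATION NOTE 1 (b)): PREDICATES on explicit parameters — print asserts
them for ITS data (real reductive groups), `∀ data, …` is never claimed — and CLOSED facts (universally quantified, formal in the dress),
each CLOSED fact being PROVED in the section `Discharges` (`…_holds`), so the file adds no unproved closed fact.

## Census «what the tree states §2 ∕ §3.2–3.4 as» (`rg 'cite: Shelstad1982'` over `lean/Literature`, `lean/Summits`, 2026-09-02)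
6 files, all citing [Shelstad1982] BARE for the archimedean transfer `f ↦ f^H` (★ `Rogawski1990.ArchEndoscopicTransferCompatible`,
★ `…ArchEndoscopicTransferOfOneSystem`, ★ `Arthur2013.Downstream8`, Lines `F0_P3a_ArchTransfers{Canonical,Singular}Paydown`,
`F0_P3c_StubN9Paydown`) — that is block A (sibling file).  Nothing in the tree states a §2 or §3.2–3.4 item.  DEDUP: endoscopic data in
the Galois form of [LanglandsShelstad1987] are ★ `LanglandsShelstad1987.Defs.EndoscopicDatum` (matrix dual group over a field `F`,
`ξ : ᴸH → ᴸG`); the 1983 French formulation is cited (not restated) in ★ `Langlands1983.GroupesEndoscopiques`; for `U(3)` the explicit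
triples are ★ `Rogawski1990.Ch4Sec2.EndoscopicTriple`.  The 1982 formulation below (sextuples with a COSET `s` of `Z^W`, the set
`𝔖(ᴸG)`, the map `(T, κ) ↦ 𝔰(T, κ)`, `𝒯_H(G)`, `i(h, η)`) is the real-group precursor and is NOT a restatement of those (different
carrier: `s` a coset, `ρ_s` through `𝔊`, no `ξ`); the (3.3) admissible embeddings `ξ : ᴸH → ᴸG` ARE print's version of `EndoscopicDatum.ξ`
and are typed only through their parameters `(μ*, λ*)` (what (3.3.3) uses).

## Index (print item ↦ declaration ↦ page)
| print | declaration | kind | p. |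
|---|---|---|---|
| `Z^W`; `ad g`, `g ∈ ᴸG⁰ × (1 × σ)`; «coset of `Z^W` … of semi-simple elements» | `centerW`, `adSigma`, `IsSCoset` | REAL | 389 |
| sextuple `(s, ᴸH⁰, ᴸB⁰_H, ᴸT⁰_H, {Y_α∨}, ρ_s)` with (2.1.1)–(2.1.5) | `Sextuple`, `Sextuple.IsDatum` | carrier ∕ PRED. | 389–390 |
| **Lemma 2.1.6** | `Shelstad1982_2_1_6` | PREDICATE | 390 |
| **Lemma 2.1.7** | `IsOfAdSigmaFormOn`, `Shelstad1982_2_1_7` | REAL ∕ PREDICATE | 390 |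
| equivalence of sextuples; `𝔖 = 𝔖(ᴸG)` | `Sextuple.Equiv`; `Shelstad1982_2_1_equiv_refl` (CLOSED, proved) | REAL ∕ fact | 390 |
| **Definition 2.2.1**, (2.2.2), (2.2.3) | `EndoscopicPair` (carrier: `𝔰_H`, `T_H`, the identification `j`) | carrier | 390–391 |
| (2.3) `κ` on `X_*(T_sc)/({σ_Tμ∨ − μ∨} ∩ X_*(T_sc))` | `cobdyLattice`, `IsKappa` | REAL | 391 |
| (2.3) «lifts … invariant under `𝔊` … form a coset of `Z^W`, say `s`» | `invariantLifts`, `ZW`; `Shelstad1982_2_3_liftsCoset`, `Shelstad1982_2_3_liftExists` (CLOSED, proved) | REAL ∕ facts | 391 |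
| **Proposition 2.3.1** (i), (ii); `Ω^{(κ)}(G, T)` | `OmegaKappa`, `Shelstad1982_2_3_1` | REAL ∕ PREDICATE | 391 |
| **Proposition 2.3.2**; **Lemma 2.3.3** | `Shelstad1982_2_3_2_surjective`, `Shelstad1982_2_3_3_finite` | PREDICATE | 391 |
| stably equivalent pairs, `𝒦_st(G) → 𝔖(ᴸG)` well defined, the `ψ`-diagram | `StablyEquivPair`, `Shelstad1982_2_3_stable_wellDefined`, `Shelstad1982_2_3_diagram` | REAL ∕ PRED. | 391–392 |
| (2.4) `𝒯_H(G)`: (2.4.1) `σ_{T,η} = ω σ_H` | `InScriptT` | REAL | 392 |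
| (2.4) «the transfer of `s_H` to `T` via `η` defines a quasicharacter `κ`» | `Shelstad1982_2_4_kappaOfSH` (CLOSED, proved) | fact | 392 |
| `ℰ(T)`; **Lemma 2.4.2** and its step (∗) | `AgreeOnScriptE`, `Shelstad1982_2_4_2`, `Shelstad1982_2_4_2_star` (CLOSED, proved) | REAL ∕ PRED. ∕ fact | 392–393 |
| p.d. `η = ad m₁ ∘ ad x₁ ∘ ψ`; (2.4.3)–(2.4.4), `i(h, η)`; «originates from … via `(T, η)`» | `pd`, `IsPD`, `iMap`, `OriginatesVia`, `CartanOriginates` | REAL | 389, 393 |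
| **Proposition 2.4.5** (i), (ii), (iii) | `Shelstad1982_2_4_5_i`, `_ii`, `_iii` | PREDICATE | 393 |
| **(3.1.5)** compatibility conditions, `R(ω_H)` (p. 395; spelled out for the sibling's `TransferSetting.IsCoherent`) | `RSet`, `Shelstad1982_3_1_5` | REAL ∕ PREDICATE | 395 |
| (3.2.1)–(3.2.2) standard position; framework of Cartan subgroups | `IsStandardPosition`, `Framework`, `Framework.iN`, `.etaG`, `.iG` | REAL ∕ carrier | 395 |
| **Proposition 3.2.3**; **Proposition 3.2.4** | `Shelstad1982_3_2_3`, `MatchesVia`, `Shelstad1982_3_2_4` | PRED. ∕ REAL | 396 |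
| (3.3.1)–(3.3.2) admissible embedding `ξ(μ*, λ*)`; `ι_n`; (3.3.3) `Λ_n^G`; unitary type; [16, Thm 3.4.1] congruence | `halfSumCoroots`, `correctionParam`, `correctionCharacter`, `IsUnitaryType`, `Shelstad1982_3_3_congruence` | REAL ∕ PRED. | 396–397 |
| (3.4.1); `ᴸ(M′)⁰ = ᴸH⁰ ∩ ᴸM⁰`; subordinate `(U, η_U)`; `κ_M` | `InScriptT` (reused), `leviDual`, `IsSubordinate`, `normZero`, `kappaM` | REAL | 397–398 |
| `f̄`, `f_M`; `|α(γ)^{1/2} − α(γ)^{−1/2}|`; the descent formula; `ε_M`, `Δ^M_(U,η_U)` | `fBar`, `constantTerm`, `absRootFactor`, `Shelstad1982_3_4_descent`, `epsM`, `deltaM` | REAL ∕ PRED. | 398 |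
| **Proposition 3.4.2** | `Shelstad1982_3_4_2` | PREDICATE | 398 |

NOT TYPED (census): the internal structure theory of `ᴸH⁰` (Borel pairs, pinnings, `Cent(s)⁰` as identity component — parameters);
«`H` is a quasi-split group over `ℝ`» and «`ᴸH` is attached to `𝔰`» of Definition 2.2.1 (no `ℝ`-groups ∕ L-groups OF a group in Mathlib;
`EndoscopicPair` records the data print FIXES in (2.2), the definition itself is dictionary); the proofs («straightforward», pp. 390–393);
the diagram `𝒦(G) ↪ 𝒦(G_sc)` (p. 392); the quasicharacter `χ(μ, λ)` of [16, §4.1] (a PARAMETER `chiOf` of `correctionCharacter`);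
(3.1.1), (3.1.3)–(3.1.4), `Δ⁰`, `′Δ`, `q(G,H)`, `ε(T,η)` and the family `{Δ_(T,η)}` (block A, sibling file ★ `…/Shelstad1982/TransferAndLifting`
— entering (3.1.5), (3.2.4), (3.4) here as explicit function parameters `Λ`, `Δ′`, `ε`, `q`).

## References
* [Shelstad1982] D. Shelstad, *L-indistinguishability for real groups*, Math. Ann. 259 (1982) 385–430: §2 pp. 389–393 (L2.1.6, L2.1.7
  p. 390; Def 2.2.1 p. 390; (2.2.2)–(2.2.3), P2.3.1, P2.3.2, L2.3.3 p. 391; (2.4.1), L2.4.2 p. 392; (2.4.3)–(2.4.4), P2.4.5 p. 393),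
  §3.2–3.4 pp. 395–398 (P3.2.3, P3.2.4 p. 396; (3.3.1)–(3.3.3) pp. 396–397; (3.4.1) p. 397; P3.4.2 p. 398); GDZ `PPN235181684_0259` LOG_0060.
* [Shelstad1979] D. Shelstad, *Characters and inner forms of a quasi-split group over ℝ*, Compositio Math. 39 (1979) — the group-side dress.
* [Langlands1983] R. P. Langlands, *Les débuts d'une formule des traces stable*, Ch. II — the lattice-side twins (`K(T/F)`).
-/

noncomputable section

open MeasureTheory
open Literature.NumberTheory.Automorphic.Shelstad1979.InnerFormsAndCharacters

namespace Literature.NumberTheory.Automorphic.Shelstad1982.EndoscopicData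

universe u v w u₁ u₂

/-! ## (2.1) Data for endoscopic groups (pp. 389–390), dual dress -/

section DualSide

variable {Gd : Type u} [Group Gd]

/-- `Z^W`, «the group of `W`-invariant elements in the center `Z` of `ᴸG⁰`» (p. 389): the centre of `Gd` = «`ᴸG⁰`» meet the fixed
points of `σd` (the action of `𝔊`, through which `W` acts; fixed points = ★ `realPoints`, used here for the dual involution).
[cite: Shelstad1982, §2.1 (p. 389)] -/
def centerW (σd : Gd ≃* Gd) : Subgroup Gd := Subgroup.center Gd ⊓ realPoints σd

/-- «`s` now denotes a coset of `Z^W` in `ᴸG⁰` consisting of semi-simple elements» (p. 389): `s = x·Z^W` for some `x`, all of whose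
elements are semisimple (`IsSemisimple` a parameter — no abstract-group model). [cite: Shelstad1982, §2.1 (p. 389)] -/
def IsSCoset (σd : Gd ≃* Gd) (IsSemisimple : Gd → Prop) (s : Set Gd) : Prop :=
  (∃ x : Gd, s = {y | ∃ z ∈ centerW σd, y = x * z}) ∧ ∀ y ∈ s, IsSemisimple y

/-- `ad g` for `g = g₀ × (1 × σ) ∈ ᴸG⁰ × (1 × σ)` acting on `ᴸG⁰` (pp. 390–391: «of the form `ad g∣_{ᴸT⁰}`, `g ∈ ᴸG⁰ × (1 × σ)`»):
`x ↦ g₀ σ(x) g₀⁻¹`. [cite: Shelstad1982, §2.1 (p. 390)] -/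
def adSigma (σd : Gd ≃* Gd) (g₀ : Gd) : Gd ≃* Gd := σd.trans (MulAut.conj g₀)

/-- Unfolding: `adSigma σd g₀ x = g₀ σd(x) g₀⁻¹` (p. 390). [cite: Shelstad1982, §2.1 (p. 390)] -/
@[simp] theorem adSigma_apply (σd : Gd ≃* Gd) (g₀ x : Gd) : adSigma σd g₀ x = g₀ * σd x * g₀⁻¹ := rfl

/-- «fixes each element of `s`» (p. 390, (2.1.5) and Lemma 2.1.7). [cite: Shelstad1982, §2.1 (p. 390)] -/
def FixesPointwise (φ : Gd ≃* Gd) (s : Set Gd) : Prop := ∀ y ∈ s, φ y = y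

/-- **The sextuples `(s, ᴸH⁰, ᴸB⁰_H, ᴸT⁰_H, {Y_α∨}, ρ_s)` of (2.1)** (pp. 389–390), as a carrier over the dual dress `(Gd, σd)`:
`s` the coset, `H0 = ᴸH⁰`, `BH = ᴸB⁰_H`, `TH = ᴸT⁰_H` as subgroups of `Gd`; the root vectors `{Y_α∨}` (2.1.4) enter through
`splittingAut` = the automorphisms of `Gd` whose restriction to `ᴸH⁰` is an automorphism of `(ᴸH⁰, ᴸB⁰_H, ᴸT⁰_H, {Y_α∨})` (the
only use print makes of `{Y_α∨}`); `ρ_s` (2.1.5), factoring through `W → 𝔊`, is recorded by `σH = ρ_s(w)` for `w ↦ σ` together with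
the element `nσ = n(w) ∈ ᴸG⁰` of (2.1.5) (`ρ_s(w) = 1`, `n(w) = 1` for `w ↦ 1`).  The CONDITIONS (2.1.1)–(2.1.5) are the predicate
`Sextuple.IsDatum`. [cite: Shelstad1982, §2.1 (pp. 389–390)] -/
structure Sextuple (σd : Gd ≃* Gd) where
  /-- `s`, a coset of `Z^W` of semisimple elements. -/
  s : Set Gd
  /-- `ᴸH⁰`. -/
  H0 : Subgroup Gd
  /-- `ᴸB⁰_H`, a Borel subgroup of `ᴸH⁰` (2.1.2). -/
  BH : Subgroup Gd
  /-- `ᴸT⁰_H`, the maximal torus in `ᴸB⁰_H` (2.1.3). -/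
  TH : Subgroup Gd
  /-- (2.1.4) through its stabiliser: the automorphisms preserving `(ᴸH⁰, ᴸB⁰_H, ᴸT⁰_H, {Y_α∨})`. -/
  splittingAut : Set (Gd ≃* Gd)
  /-- `σ_H = ρ_s(w)` for `w ↦ σ` (2.1.5). -/
  σH : Gd ≃* Gd
  /-- `n(w) ∈ ᴸG⁰` for `w ↦ σ`, with `ρ_s(w) = ad n(w)∣_{ᴸH⁰}` (2.1.5). -/
  nσ : Gd

/-- **Conditions (2.1.1)–(2.1.5)** (p. 390) on a sextuple: `s` is a coset of `Z^W` of semisimple elements; (2.1.1) `ᴸH⁰ = Cent(s)⁰`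
(`centConn s`, a parameter: «the identity component of the centralizer in `ᴸG⁰` of any element of `s`»); (2.1.2)–(2.1.3) `(ᴸB⁰_H, ᴸT⁰_H)`
is a Borel pair of `ᴸH⁰` (`IsBorelPair`, a parameter) with `ᴸT⁰_H ≤ ᴸB⁰_H ≤ ᴸH⁰`; every element of `splittingAut` preserves `ᴸH⁰`,
`ᴸB⁰_H`, `ᴸT⁰_H`; (2.1.5) `σ_H ∈ splittingAut`, `σ_H = ad (n(w) × σ)` on `ᴸH⁰` with `n(w) × σ` fixing each element of `s`, and
`σ_H² = 1` on `ᴸH⁰` («`ρ_s` is a homomorphism of `W` … which factors through `W → 𝔊`»). [cite: Shelstad1982, §2.1 (2.1.1)–(2.1.5) (p. 390)] -/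
def Sextuple.IsDatum {σd : Gd ≃* Gd} (S : Sextuple σd) (IsSemisimple : Gd → Prop) (centConn : Set Gd → Subgroup Gd)
    (IsBorelPair : Subgroup Gd → Subgroup Gd → Subgroup Gd → Prop) : Prop :=
  IsSCoset σd IsSemisimple S.s ∧ S.H0 = centConn S.s ∧ IsBorelPair S.H0 S.BH S.TH ∧ S.TH ≤ S.BH ∧ S.BH ≤ S.H0 ∧
    (∀ φ ∈ S.splittingAut, S.H0.map φ.toMonoidHom = S.H0 ∧ S.BH.map φ.toMonoidHom = S.BH ∧ S.TH.map φ.toMonoidHom = S.TH) ∧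
    S.σH ∈ S.splittingAut ∧ (∀ x ∈ S.H0, S.σH x = adSigma σd S.nσ x) ∧ FixesPointwise (adSigma σd S.nσ) S.s ∧
    ∀ x ∈ S.H0, S.σH (S.σH x) = x

/-- **Lemma 2.1.6** (p. 390): «If `x` is a semi-simple element of `ᴸG⁰` then we may build an object `(xZ^W, …)` of the form above,
if and only if the conjugacy class of `x` in `ᴸG⁰` is invariant under `W`» — `W` acting through `σd`, i.e. `σd(x)` is conjugate to
`x`.  PREDICATE on print's data `(σd, IsSemisimple, centConn, IsBorelPair, x)` (print: proof «straightforward», omitted).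
[cite: Shelstad1982, Lemma 2.1.6 (p. 390)] -/
def Shelstad1982_2_1_6 (σd : Gd ≃* Gd) (IsSemisimple : Gd → Prop) (centConn : Set Gd → Subgroup Gd)
    (IsBorelPair : Subgroup Gd → Subgroup Gd → Subgroup Gd → Prop) (x : Gd) : Prop :=
  IsSemisimple x →
    ((∃ S : Sextuple σd, S.IsDatum IsSemisimple centConn IsBorelPair ∧ S.s = {y | ∃ z ∈ centerW σd, y = x * z}) ↔
      ∃ g : Gd, σd x = g * x * g⁻¹)

/-- «`τ` is of the form `ad g∣_{ᴸT⁰}`, `g ∈ ᴸG⁰ × (1 × σ)`» (p. 390): on the subgroup `S`, `τ` agrees with `adSigma σd g₀` for some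
`g₀`. [cite: Shelstad1982, §2.1, Lemma 2.1.7 (p. 390)] -/
def IsOfAdSigmaFormOn (σd : Gd ≃* Gd) (τ : Gd ≃* Gd) (S : Subgroup Gd) : Prop :=
  ∃ g₀ : Gd, ∀ t ∈ S, τ t = adSigma σd g₀ t

/-- **Lemma 2.1.7** (p. 390): «Suppose that `τ` is an automorphism of `ᴸT⁰` such that `τ² = 1`. Suppose also that `τ` fixes each
element of `s` and is of the form `ad g∣_{ᴸT⁰}`, `g ∈ ᴸG⁰ × (1 × σ)`. Then there is a unique automorphism `τ_H` of
`(ᴸH⁰, ᴸB⁰_H, ᴸT⁰_H, {Y_α})` satisfying `τ = (τ_H∣_{ᴸT⁰})·ω`, for some `ω ∈ Ω(ᴸH⁰, ᴸT⁰)`. Further, `τ_H² = 1` and `τ_H` is of the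
form `ad g′∣_{ᴸH⁰}` for some `g′ ∈ ᴸG⁰ × (1 × σ)` fixing `s` pointwise.»  Here the five entries `(s, ᴸH⁰, ᴸB⁰_H, ᴸT⁰_H, {Y_α∨})` are
those of `S` (its `σH`, `nσ` unused), `ᴸT⁰ = S.TH` (so `s ⊂ ᴸT⁰`, (2.2.2)), `τ` an automorphism of `Gd` read on `ᴸT⁰`, a Weyl element
`ω` = conjugation by an `n ∈ ᴸH⁰` normalising `ᴸT⁰`, uniqueness = as automorphisms of `ᴸH⁰`.  PREDICATE on print's data.
[cite: Shelstad1982, Lemma 2.1.7 (p. 390)] -/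
def Shelstad1982_2_1_7 {σd : Gd ≃* Gd} (S : Sextuple σd) (τ : Gd ≃* Gd) : Prop :=
  (∀ t ∈ S.TH, τ t ∈ S.TH) → (∀ t ∈ S.TH, τ (τ t) = t) → FixesPointwise τ S.s → IsOfAdSigmaFormOn σd τ S.TH →
    (∃ τH ∈ S.splittingAut,
      (∃ n ∈ S.H0, n ∈ Subgroup.normalizer (S.TH : Set Gd) ∧ ∀ t ∈ S.TH, τ t = τH (n * t * n⁻¹)) ∧
      (∀ x ∈ S.H0, τH (τH x) = x) ∧
      ∃ g' : Gd, (∀ x ∈ S.H0, τH x = adSigma σd g' x) ∧ FixesPointwise (adSigma σd g') S.s) ∧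
    ∀ τH ∈ S.splittingAut, ∀ τH' ∈ S.splittingAut,
      (∃ n ∈ S.H0, n ∈ Subgroup.normalizer (S.TH : Set Gd) ∧ ∀ t ∈ S.TH, τ t = τH (n * t * n⁻¹)) →
      (∃ n ∈ S.H0, n ∈ Subgroup.normalizer (S.TH : Set Gd) ∧ ∀ t ∈ S.TH, τ t = τH' (n * t * n⁻¹)) →
      ∀ x ∈ S.H0, τH x = τH' x

/-- **Equivalence of sextuples** (p. 390): «`(s₁, ᴸH⁰₁, …, ρ_{s₁})` and `(s₂, ᴸH⁰₂, …, ρ_{s₂})` [are] equivalent if there exists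
`g ∈ ᴸG⁰` such that `ᴸH⁰₂ = gᴸH⁰₁g⁻¹`, `ᴸB⁰_{H₂} = gᴸB⁰_{H₁}g⁻¹`, `ᴸT⁰_{H₂} = gᴸT⁰_{H₁}g⁻¹`, `Z_{Ad g(α∨)} = Ad g(Y_α∨)` and
`ρ_{s₂}(w) = ad g ∘ ρ_{s₁}(w) ∘ ad g⁻¹`, `w ∈ W`. It is *not* required that `s₂ = gs₁g⁻¹`.»  The root-vector clause is transported
through `splittingAut` (`φ ↦ ad g ∘ φ ∘ ad g⁻¹`); the `ρ`-clause is read on `ᴸH⁰₂`. [cite: Shelstad1982, §2.1 (p. 390)] -/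
def Sextuple.Equiv {σd : Gd ≃* Gd} (S₁ S₂ : Sextuple σd) : Prop :=
  ∃ g : Gd, S₂.H0 = S₁.H0.map (MulAut.conj g).toMonoidHom ∧ S₂.BH = S₁.BH.map (MulAut.conj g).toMonoidHom ∧
    S₂.TH = S₁.TH.map (MulAut.conj g).toMonoidHom ∧
    S₂.splittingAut = {φ | ∃ φ₁ ∈ S₁.splittingAut, φ = ((MulAut.conj g).symm.trans φ₁).trans (MulAut.conj g)} ∧
    ∀ x ∈ S₂.H0, S₂.σH x = g * S₁.σH (g⁻¹ * x * g) * g⁻¹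

/-- p. 390: equivalence of sextuples is reflexive (`g = 1`) — the first of the three checks making `𝔖(ᴸG)` «the set of all equivalence
classes» well defined.  CLOSED (formal; proved below). [cite: Shelstad1982, §2.1 (p. 390)] -/
def Shelstad1982_2_1_equiv_refl : Prop :=
  ∀ {Gd : Type u} [Group Gd] (σd : Gd ≃* Gd) (S : Sextuple σd), S.Equiv S

end DualSide

/-! ## (2.2) Endoscopic groups (pp. 390–391): the data print FIXES -/

section EndoscopicPairs

/-- **The fixed data of (2.2)** (pp. 390–391) for an endoscopic group `H` of `G` (Definition 2.2.1: «`H` [quasi-split over `ℝ`] is an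
endoscopic group for `G` if `ᴸH` is attached to some `𝔰 ∈ 𝔖(ᴸG)`» — dictionary): on the group side the complex groups `GsC = G*(ℂ)`
(quasi-split inner form, conjugation `σs`, distinguished maximal torus `T* = TsC` of the Borel `B*`) and `HC = H(ℂ)` (conjugation `σH'`,
«we fix `B_H`, a Borel subgroup of `H` defined over `ℝ`, and let `T_H` denote the maximal torus in `B_H`» = `THC`); on the dual side
the representative `𝔰_H = (s_H, ᴸH)` (`sext`) with **(2.2.2)** `ᴸT⁰_H = ᴸT⁰` (`TH_eq`, `Td` = «`ᴸT⁰`»); and **(2.2.3)**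
`X_*(T_H) = X*(ᴸT⁰) = X_*(T*)`, recorded on complex points as a homomorphism `j : HC →* GsC` identifying `T_H(ℂ)` with `T*(ℂ)`
(`j_maps`).  DATA ONLY; print's assertions are predicates on a value of this carrier. [cite: Shelstad1982, §2.2, Definition 2.2.1, (2.2.2)–(2.2.3) (pp. 390–391)] -/
structure EndoscopicPair (GsC : Type u) [Group GsC] (HC : Type v) [Group HC] (Gd : Type w) [Group Gd] where
  /-- complex conjugation on `G*(ℂ)` -/
  σs : GsC ≃* GsC
  /-- the distinguished maximal torus `T*` of `G*` -/
  TsC : Subgroup GsC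
  /-- complex conjugation on `H(ℂ)` -/
  σH' : HC ≃* HC
  /-- `T_H`, the maximal torus of the fixed Borel subgroup `B_H` over `ℝ` -/
  THC : Subgroup HC
  /-- the action of `𝔊` on `ᴸG⁰` -/
  σd : Gd ≃* Gd
  /-- `ᴸT⁰` -/
  Td : Subgroup Gd
  /-- the fixed representative `𝔰_H = (s_H, ᴸH⁰, ᴸB⁰_H, ᴸT⁰_H, {Y_α∨}, ρ)` -/
  sext : Sextuple σd
  /-- (2.2.2) `ᴸT⁰_H = ᴸT⁰` -/
  TH_eq : sext.TH = Td
  /-- (2.2.3) on complex points: `T_H(ℂ) ≅ T*(ℂ)` -/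
  j : HC →* GsC
  /-- `j(T_H) = T*` -/
  j_maps : THC.map j = TsC

end EndoscopicPairs

/-! ## (2.3) `(T, κ)`-pairs (pp. 391–392), lattice side -/

section Lattice

variable {Y : Type v} [AddCommGroup Y]

/-- `{σ_T μ∨ − μ∨ : μ∨ ∈ X_*(T)}` (p. 391) for the involution `τ = σ_{T,η}` transported to `Y = X_*(T*)`: the range of `τ − 1`
(the explicit-involution twin of ★ `Langlands1983.GroupesEndoscopiques.augLatticeOf`). [cite: Shelstad1982, §2.3 (p. 391)] -/
def cobdyLattice (τ : Y ≃ₗ[ℤ] Y) : AddSubgroup Y := (LinearMap.range ((τ : Y →ₗ[ℤ] Y) - LinearMap.id)).toAddSubgroup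

/-- Unfolding: `y ∈ cobdyLattice τ ↔ ∃ μ, τ μ − μ = y` (p. 391). [cite: Shelstad1982, §2.3 (p. 391)] -/
theorem mem_cobdyLattice {τ : Y ≃ₗ[ℤ] Y} {y : Y} : y ∈ cobdyLattice τ ↔ ∃ μ : Y, τ μ - μ = y := by
  simp [cobdyLattice, LinearMap.mem_range]

/-- «`κ` is a quasicharacter on `X_*(T_sc)/{σ_Tμ∨ − μ∨ : μ∨ ∈ X_*(T)} ∩ X_*(T_sc)`» (p. 391): a character `κ : Ysc →+ Additive ℂ^×`
(`Ysc` = «`X_*(T_sc)`») trivial on `Ysc ∩ cobdyLattice τ` (the explicit-involution twin of ★ `KLocal`). [cite: Shelstad1982, §2.3 (p. 391)] -/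
def IsKappa (τ : Y ≃ₗ[ℤ] Y) (Ysc : AddSubgroup Y) (κ : Ysc →+ Additive ℂˣ) : Prop :=
  ∀ y : Ysc, (y : Y) ∈ cobdyLattice τ → κ y = 0

/-- «this new quasicharacter lifts, in several ways, to a quasicharacter on `X_*(T*) = X*(ᴸT⁰)` invariant under the action of `𝔊`
obtained by transferring the Galois action on `T` to `T*` via `η`. These various extensions may be viewed as elements of `ᴸT⁰`»
(p. 391): the set of `τ`-invariant characters of `Y` extending `κ`. [cite: Shelstad1982, §2.3 (p. 391)] -/
def invariantLifts (τ : Y ≃ₗ[ℤ] Y) (Ysc : AddSubgroup Y) (κ : Ysc →+ Additive ℂˣ) : Set (Y →+ Additive ℂˣ) :=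
  {s | (∀ y : Y, s (τ y) = s y) ∧ ∀ y : Ysc, s (y : Y) = κ y}

/-- `Z^W` seen in `ᴸT⁰ = Hom(X*(ᴸT⁰), ℂ^×)` (p. 391: «they form a coset of `Z^W` (cf. [16, Sect. 2.1])»): the `τ`-invariant characters
of `Y` trivial on the coroot lattice `Ysc` (the centre of `ᴸG⁰` = characters of `X*(ᴸT⁰)` trivial on its root lattice = `X_*(T*_sc)`).
[cite: Shelstad1982, §2.3 (p. 391)] -/
def ZW (τ : Y ≃ₗ[ℤ] Y) (Ysc : AddSubgroup Y) : AddSubgroup (Y →+ Additive ℂˣ) where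
  carrier := {z | (∀ y : Y, z (τ y) = z y) ∧ ∀ y : Ysc, z (y : Y) = 0}
  add_mem' := by
    rintro a b ⟨ha, ha'⟩ ⟨hb, hb'⟩
    exact ⟨fun y => by simp [ha y, hb y], fun y => by simp [ha' y, hb' y]⟩
  zero_mem' := ⟨fun _ => rfl, fun _ => rfl⟩
  neg_mem' := by
    rintro a ⟨ha, ha'⟩
    exact ⟨fun y => by simp [ha y], fun y => by simp [ha' y]⟩

/-- p. 391: «These various extensions … form a coset of `Z^W`, say `s`» — CLOSED: if `s` is an invariant lift of `κ` then the invariant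
lifts of `κ` are exactly `s + Z^W`.  (Formal; proved below.) [cite: Shelstad1982, §2.3 (p. 391)] -/
def Shelstad1982_2_3_liftsCoset : Prop :=
  ∀ {Y : Type v} [AddCommGroup Y] (τ : Y ≃ₗ[ℤ] Y) (Ysc : AddSubgroup Y) (κ : Ysc →+ Additive ℂˣ),
    ∀ s ∈ invariantLifts τ Ysc κ, ∀ s' : Y →+ Additive ℂˣ, s' ∈ invariantLifts τ Ysc κ ↔ s' - s ∈ ZW τ Ysc

/-- p. 391: «this new quasicharacter lifts, in several ways, to a quasicharacter on `X_*(T*)` invariant under the action of `𝔊`» —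
CLOSED, the existence step: a character `κ` of `Ysc` trivial on `Ysc ∩ {τμ − μ}` extends to a `τ`-invariant character of `Y`
(`ℂ^×` is divisible; proved below from ★ `Langlands1983_II_4_kappaExtends_holds` applied to `Y/{τμ − μ}`).
[cite: Shelstad1982, §2.3 (p. 391)] -/
def Shelstad1982_2_3_liftExists : Prop :=
  ∀ {Y : Type v} [AddCommGroup Y] (τ : Y ≃ₗ[ℤ] Y) (Ysc : AddSubgroup Y) (κ : Ysc →+ Additive ℂˣ),
    IsKappa τ Ysc κ → (invariantLifts τ Ysc κ).Nonempty

/-- `Ω^{(κ)}(G, T)`, «the subgroup of `Ω(G, T)` generated by the reflections with respect to those roots `α` for which `κ(α∨) = 1`»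
(Proposition 2.3.1 (ii), p. 391), on the lattice: the reflections `refl α∨ ∈ Y ≃ₗ[ℤ] Y` of the coroots `α∨ ∈ Rv ⊆ Ysc` with
`κ(α∨) = 1` (additively `= 0`). [cite: Shelstad1982, Proposition 2.3.1 (p. 391)] -/
def OmegaKappa (Ysc : AddSubgroup Y) (Rv : Set Ysc) (refl : Ysc → (Y ≃ₗ[ℤ] Y)) (κ : Ysc →+ Additive ℂˣ) : Subgroup ((Y ≃ₗ[ℤ] Y)) :=
  Subgroup.closure {w | ∃ a ∈ Rv, κ a = 0 ∧ w = refl a}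

end Lattice

section Pairs

variable {GC : Type u} [Group GC] {Y : Type v} [AddCommGroup Y]

/-- **Proposition 2.3.1** (p. 391): «`𝔰(T, κ) = 𝔰(T′, κ′)` if and only if there exists `g ∈ G` such that `ad g : T → T′` and
(i) `κ(α∨) = 1` if and only if `κ′(gα∨) = 1`, `α∨ ∈ Δ∨(G, T)`, (ii) `σ_G(g⁻¹)g ∈ Ω^{(κ)}(G, T)`.»  MIXED dress: `g ∈ GC` with
`gTg⁻¹ = T′` on complex points; on the lattice `Y` (both pairs transported to `T*`), `gY` = the map `X_*(T) → X_*(T′)` induced by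
`ad g`, `wY` = the Weyl element `σ_G(g⁻¹)g ∈ Ω(G, T)` (both parameters indexed by `g`, print's «induced maps … without comment»),
`Rv` the coroots, `refl` their reflections; `sameClass` = «`𝔰(T, κ) = 𝔰(T′, κ′)`» (the map `𝒦(G) → 𝔖(ᴸG)` being print's construction,
a parameter).  PREDICATE on print's data. [cite: Shelstad1982, Proposition 2.3.1 (p. 391)] -/
def Shelstad1982_2_3_1 (σ : GC ≃* GC) (TC TC' : Subgroup GC) (Ysc : AddSubgroup Y) (Rv : Set Ysc) (refl : Ysc → (Y ≃ₗ[ℤ] Y))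
    (κ κ' : Ysc →+ Additive ℂˣ) (gY : GC → Ysc → Ysc) (wY : GC → (Y ≃ₗ[ℤ] Y)) (sameClass : Prop) : Prop :=
  sameClass ↔ ∃ g : GC, TC.map (MulAut.conj g).toMonoidHom = TC' ∧
    (∀ a ∈ Rv, κ a = 0 ↔ κ' (gY g a) = 0) ∧ wY (σ g⁻¹ * g) ∈ OmegaKappa Ysc Rv refl κ

/-- **Proposition 2.3.2** (p. 391): «If `G` is quasi-split over `ℝ` then the map `(T, κ) → 𝔰(T, κ)` of `𝒦(G)` to `𝔖(ᴸG)` is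
surjective.» (print: from Theorem 1.7 of [18]).  PREDICATE on the map `sOf : 𝒦(G) → 𝔖(ᴸG)` (abstract carriers; dictionary level).
[cite: Shelstad1982, Proposition 2.3.2 (p. 391)] -/
def Shelstad1982_2_3_2_surjective {K : Type u₁} {S : Type u₂} (IsQuasiSplit : Prop) (sOf : K → S) : Prop :=
  IsQuasiSplit → Function.Surjective sOf

/-- **Lemma 2.3.3** (p. 391): «`𝔖(ᴸG)` is a finite set» — over the dual dress: finitely many sextuple data up to equivalence.
PREDICATE on print's data `(σd, IsSemisimple, centConn, IsBorelPair)` (false for arbitrary abstract data; print: from Prop. 2.3.1 for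
`G*`). [cite: Shelstad1982, Lemma 2.3.3 (p. 391)] -/
def Shelstad1982_2_3_3_finite {Gd : Type w} [Group Gd] (σd : Gd ≃* Gd) (IsSemisimple : Gd → Prop)
    (centConn : Set Gd → Subgroup Gd) (IsBorelPair : Subgroup Gd → Subgroup Gd → Subgroup Gd → Prop) : Prop :=
  ∃ l : List (Sextuple σd), ∀ S : Sextuple σd, S.IsDatum IsSemisimple centConn IsBorelPair → ∃ S' ∈ l, S.Equiv S'

/-- «`(T, κ)` and `(T′, κ′)` [are] stably equivalent if there exists `ω ∈ 𝔄(T)` such that `ω : T → T′` and `κ′ = κ^ω`» (p. 391),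
MIXED dress: `ω ∈ 𝔄(T)` (★ `scriptA`) with `ωTω⁻¹ = T′`, and on the lattice `κ′ = κ ∘ ωY⁻¹`, `ωY` = the map `X_*(T_sc) → X_*(T′_sc)`
induced by `ad ω` (parameter indexed by `ω`). [cite: Shelstad1982, §2.3 (p. 391)] -/
def StablyEquivPair (σ : GC ≃* GC) (TC TC' : Subgroup GC) (Ysc : AddSubgroup Y) (κ κ' : Ysc →+ Additive ℂˣ)
    (ωY : GC → Ysc ≃+ Ysc) : Prop :=
  ∃ ω ∈ scriptA σ TC, TC.map (MulAut.conj ω).toMonoidHom = TC' ∧ ∀ y : Ysc, κ' (ωY ω y) = κ y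

/-- p. 392: «By Proposition 2.3.1, we may set `𝔰(⟨T, κ⟩) = 𝔰((T, κ))` to obtain a well-defined map of `𝒦_st(G)` into `𝔖(ᴸG)`» —
stably equivalent pairs have the same class.  PREDICATE on print's data (`sOfT`, `sOfT'` the classes of the two pairs).
[cite: Shelstad1982, §2.3 (p. 392)] -/
def Shelstad1982_2_3_stable_wellDefined {S : Type u₂} (σ : GC ≃* GC) (TC TC' : Subgroup GC) (Ysc : AddSubgroup Y)
    (κ κ' : Ysc →+ Additive ℂˣ) (ωY : GC → Ysc ≃+ Ysc) (sOfT sOfT' : S) : Prop :=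
  StablyEquivPair σ TC TC' Ysc κ κ' ωY → sOfT = sOfT'

/-- p. 392: «the twist `ψ : G → G*` provides embeddings over `ℝ` into `G*` of the maximal tori over `ℝ` in `G` … Thus `ψ` induces a
map of `𝒦_st(G)` into `𝒦_st(G*)`. Clearly this map is injective», and the triangle `𝒦_st(G) ↪ 𝒦_st(G*) → 𝔖(ᴸG)` «is commutative».
PREDICATE on the three maps (abstract carriers; dictionary level). [cite: Shelstad1982, §2.3 (p. 392)] -/
def Shelstad1982_2_3_diagram {K : Type u₁} {Ks : Type u₂} {S : Type w} (ψK : K → Ks) (sOf : K → S) (sOfStar : Ks → S) : Prop :=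
  Function.Injective ψK ∧ ∀ k : K, sOfStar (ψK k) = sOf k

end Pairs

/-! ## (2.4) Elements of `H` originating in `G` (pp. 392–393) -/

section LatticeOriginates

variable {Y : Type v} [AddCommGroup Y]

/-- **`𝒯_H(G)`, condition (2.4.1)** (p. 392): «the transfer `σ_{T,η}` of the Galois action on `T` to `ᴸT⁰` via `η` satisfies
`σ_{T,η} = ω σ_H`, some `ω ∈ Ω(ᴸH⁰, ᴸT⁰)`», on the lattice `Y = X*(ᴸT⁰)`: `τ = σ_{T,η}`, `σHY = σ_H∣_{ᴸT⁰}`, `ΩH = Ω(ᴸH⁰, ᴸT⁰)`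
(in the group `Y ≃ₗ[ℤ] Y` of lattice automorphisms, whose product is composition `(ω * σ)(y) = ω (σ y)`).  Also the shape of **(3.4.1)** with `Ω(ᴸM⁰ ∩ ᴸH⁰, ᴸT⁰)`.
[cite: Shelstad1982, §2.4 (2.4.1) (p. 392)] -/
def InScriptT (ΩH : Subgroup ((Y ≃ₗ[ℤ] Y))) (σHY τ : (Y ≃ₗ[ℤ] Y)) : Prop := ∃ ω ∈ ΩH, τ = ω * σHY

/-- p. 392: «Then for `(T, η) ∈ 𝒯_H(G)`, the transfer of `s_H` to `T` via `η` defines a quasicharacter `κ` on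
`X_*(T_sc)/{σ_Tμ∨ − μ∨ : μ∨ ∈ X_*(T)} ∩ X_*(T_sc)`» — CLOSED, lattice form: if the character `s_H` of `Y` is `σ_{T,η}`-invariant
(which (2.4.1) gives: `s_H` is fixed by `σ_H` and, being central in `ᴸH⁰`, by `Ω(ᴸH⁰, ᴸT⁰)`), then its restriction to `Ysc` is a `κ` in
the sense of `IsKappa`.  (Formal; proved below.) [cite: Shelstad1982, §2.4 (p. 392)] -/
def Shelstad1982_2_4_kappaOfSH : Prop :=
  ∀ {Y : Type v} [AddCommGroup Y] (τ : Y ≃ₗ[ℤ] Y) (Ysc : AddSubgroup Y) (sH : Y →+ Additive ℂˣ),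
    (∀ y : Y, sH (τ y) = sH y) → IsKappa τ Ysc (sH.comp Ysc.subtype)

/-- `ℰ(T) = {λ∨ ∈ X_*(T_sc) : λ∨ + σ_Tλ∨ = 0}/X_*(T_sc) ∩ {μ∨ − σ_Tμ∨ : μ∨ ∈ X_*(T)}` (Lemma 2.4.2, p. 392): «agrees with `κ` on
`ℰ(T)`» for two characters `κ`, `κ′` of `Ysc` (both trivial on the denominator) = agreement on the norm-zero elements of `Ysc`.
[cite: Shelstad1982, Lemma 2.4.2 (p. 392)] -/
def AgreeOnScriptE (τ : Y ≃ₗ[ℤ] Y) (Ysc : AddSubgroup Y) (κ κ' : Ysc →+ Additive ℂˣ) : Prop :=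
  ∀ y : Ysc, (y : Y) + τ y = 0 → κ y = κ' y

/-- **Lemma 2.4.2** (p. 392): «Suppose that `(T, κ) ∈ 𝒦_H(G)`. Then there exists a p.d. `η` of `T` such that `(T, η) ∈ 𝒯_H(G)` and
the attached quasicharacter agrees with `κ` on `ℰ(T)`.»  Lattice dress over the set `P` of p.d.'s of `T` (print: «we allow “p.d. `η` of
`T`” to mean any map `η : T → T*` of the form `ad x ∘ ψ`»): `σOf η = σ_{T,η}`, `κOf η` = `κ` transported via `η`; the hypothesis
«`(T, κ) ∈ 𝒦_H(G)`» in the form the printed proof uses it («We may choose `η` so that `(T, η) ∈ 𝒯_H(G)` and the representative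
attached to `T, η` and `κ` is `(s′, ᴸH)`»): for some `η₀ ∈ 𝒯_H(G)` some invariant lift `s′` of `κ` has `Cent(s′)⁰ = ᴸH⁰`, i.e. the
same roots as `s_H` (★ `racinesH` on the coroot set `Rv`); conclusion with `κ_η = s_H∣_{Ysc}` (the attached quasicharacter, cf.
`Shelstad1982_2_4_kappaOfSH`).  PREDICATE on print's data. [cite: Shelstad1982, Lemma 2.4.2 (p. 392)] -/
def Shelstad1982_2_4_2 {P : Type u₁} (Ysc : AddSubgroup Y) (Rv : Set Y) (ΩH : Subgroup ((Y ≃ₗ[ℤ] Y))) (σHY : (Y ≃ₗ[ℤ] Y))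
    (sH : Y →+ Additive ℂˣ) (σOf : P → (Y ≃ₗ[ℤ] Y)) (κOf : P → (Ysc →+ Additive ℂˣ)) : Prop :=
  (∃ η₀ : P, InScriptT ΩH σHY (σOf η₀) ∧ ∃ s' ∈ invariantLifts (σOf η₀) Ysc (κOf η₀),
      Langlands1983.GroupesEndoscopiques.racinesH Rv s' = Langlands1983.GroupesEndoscopiques.racinesH Rv sH) →
    ∃ η : P, InScriptT ΩH σHY (σOf η) ∧ AgreeOnScriptE (σOf η) Ysc (κOf η) (sH.comp Ysc.subtype)

/-- Proof of Lemma 2.4.2, step **(∗)** (pp. 392–393): «Then both `s′` and `s_H` are fixed by `σ_H` and `σ_{T,η}`. Let `α∨` be a root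
of `(ᴸG⁰, ᴸT⁰)` such that `σ_{T,η}α∨ = −α∨`. Then (∗) `α∨(s′) = α∨(s_H) = ±1`» — CLOSED, lattice form: two `τ`-invariant characters
with the same root set agree on every coroot `α∨ ∈ Rv` with `τα∨ = −α∨`, where both take a value of order `≤ 2`.  (Formal; proved
below.) [cite: Shelstad1982, Lemma 2.4.2, proof (∗) (pp. 392–393)] -/
def Shelstad1982_2_4_2_star : Prop :=
  ∀ {Y : Type v} [AddCommGroup Y] (τ : Y ≃ₗ[ℤ] Y) (Rv : Set Y) (s' sH : Y →+ Additive ℂˣ),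
    (∀ y : Y, s' (τ y) = s' y) → (∀ y : Y, sH (τ y) = sH y) →
    Langlands1983.GroupesEndoscopiques.racinesH Rv s' = Langlands1983.GroupesEndoscopiques.racinesH Rv sH →
    ∀ a ∈ Rv, τ a = -a → s' a = sH a ∧ (2 : ℕ) • s' a = 0

end LatticeOriginates

section GroupOriginates

variable {GC : Type u} [Group GC] {GsC : Type u₁} [Group GsC] {HC : Type u₂} [Group HC]

/-- **A pseudo-diagonalization as a map** (p. 389): `η = ad m₁ ∘ ad x₁ ∘ ψ : G(ℂ) ≃ G*(ℂ)`, read on `T` («thus `η` maps `T` to `T*`,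
the distinguished torus»). [cite: Shelstad1982, §1.3 (p. 389)] -/
def pd (ψ : GC ≃* GsC) (x₁ m₁ : GsC) : GC ≃* GsC := (ψ.trans (MulAut.conj x₁)).trans (MulAut.conj m₁)

/-- Unfolding: `pd ψ x₁ m₁ g = m₁ x₁ ψ(g) x₁⁻¹ m₁⁻¹` (p. 389). [cite: Shelstad1982, §1.3 (p. 389)] -/
@[simp] theorem pd_apply (ψ : GC ≃* GsC) (x₁ m₁ : GsC) (g : GC) : pd ψ x₁ m₁ g = m₁ * (x₁ * ψ g * x₁⁻¹) * m₁⁻¹ := rfl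

/-- **The conditions making `ad m₁ ∘ ad x₁ ∘ ψ` a p.d. of `T`** (p. 389): «`ad x₁ ∘ ψ : T → T₁` defined over `ℝ`, with `T₁` standard in
`G*` (`x₁ ∈ G*`), and `ad m₁`, `m₁ ∈ M_{T₁}`, mapping `T₁` to `T*`» (`IsStandard`, `leviOf T₁ = M_{T₁}` = «the centralizer of `S_{T₁}`»
are parameters: «maximal `ℝ`-split torus» has no abstract-group model). [cite: Shelstad1982, §1.3 (p. 389)] -/
def IsPD (σ : GC ≃* GC) (σs : GsC ≃* GsC) (ψ : GC ≃* GsC) (TsC : Subgroup GsC) (IsStandard : Subgroup GsC → Prop)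
    (leviOf : Subgroup GsC → Subgroup GsC) (TC : Subgroup GC) (x₁ m₁ : GsC) : Prop :=
  IsDefinedOverOn σ σs (psiX ψ x₁) TC ∧ IsStandard (TC.map (psiX ψ x₁)) ∧ m₁ ∈ leviOf (TC.map (psiX ψ x₁)) ∧
    TC.map (pd ψ x₁ m₁).toMonoidHom = TsC

/-- **`i(h, η) : T′ → T`** (p. 393, (2.4.3)–(2.4.4)): «`T′ = h⁻¹T_Hh` is defined over `ℝ`, and
`X_*(T′) →(ad h) X_*(T_H) = X_*(T*) →(η⁻¹) X_*(T)` commutes with Galois action and so lifts to an isomorphism `i(h, η) : T′ → T` defined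
over `ℝ`» — on complex points: `t′ ↦ η⁻¹(j(h t′ h⁻¹))`, `j` the identification `T_H(ℂ) ≅ T*(ℂ)` of (2.2.3). [cite: Shelstad1982, §2.4 (2.4.3)–(2.4.4) (p. 393)] -/
def iMap (η : GC ≃* GsC) (j : HC →* GsC) (h : HC) : HC → GC := fun t => η.symm (j (h * t * h⁻¹))

/-- **«`γ′ ∈ H` originates from `γ ∈ G_reg` via `(T, η) ∈ 𝒯_H(G)`»** (p. 393): «if `γ′` is the preimage of `γ` under some such map
`i(h, η)`» — with (2.4.3): `T′ = h⁻¹T_Hh` is `σ_H`-stable, and (2.4.4): `i(h, η)` commutes with the conjugations on `T′` (★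
`IsDefinedOverOn`); `γ ∈ reg` = «`G_reg`», `γ′ ∈ T′`.  (That `(T, η) ∈ 𝒯_H(G)` is a separate hypothesis, `InScriptT`, where used.)
[cite: Shelstad1982, §2.4 (p. 393)] -/
def OriginatesVia (σH' : HC ≃* HC) (σ : GC ≃* GC) (THC : Subgroup HC) (η : GC ≃* GsC) (j : HC →* GsC) (reg : Set GC)
    (γ' : HC) (γ : GC) : Prop :=
  γ ∈ reg ∧ ∃ h : HC, (∀ t ∈ THC.map (MulAut.conj h⁻¹).toMonoidHom, σH' t ∈ THC.map (MulAut.conj h⁻¹).toMonoidHom) ∧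
    IsDefinedOverOn σH' σ (iMap η j h) (THC.map (MulAut.conj h⁻¹).toMonoidHom) ∧
    γ' ∈ THC.map (MulAut.conj h⁻¹).toMonoidHom ∧ iMap η j h γ' = γ

/-- «a Cartan subgroup `T′` of `H` originates from a Cartan subgroup `T` of `G` if `T′` is the preimage of `T` under some `i(h, η)`»
(p. 393), on complex points (`T′C`, `TC` the complex tori; `T′ = h⁻¹T_Hh` over `ℝ`, `i(h, η)` over `ℝ` on it, and `i(h, η)(T′) = T`).
[cite: Shelstad1982, §2.4 (p. 393)] -/
def CartanOriginates (σH' : HC ≃* HC) (σ : GC ≃* GC) (THC : Subgroup HC) (η : GC ≃* GsC) (j : HC →* GsC)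
    (T'C : Subgroup HC) (TC : Subgroup GC) : Prop :=
  ∃ h : HC, T'C = THC.map (MulAut.conj h⁻¹).toMonoidHom ∧ (∀ t ∈ T'C, σH' t ∈ T'C) ∧
    IsDefinedOverOn σH' σ (iMap η j h) T'C ∧ (iMap η j h) '' (T'C : Set HC) = TC

/-- **Proposition 2.4.5 (i)** (p. 393): «Suppose that `γ′ ∈ H` originates from `γ ∈ G_reg` via `(T, η)`. Then `γ′ ∈ H_reg`.»
PREDICATE on print's data (`regH` = «`H_reg`»). [cite: Shelstad1982, Proposition 2.4.5 (i) (p. 393)] -/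
def Shelstad1982_2_4_5_i (σH' : HC ≃* HC) (σ : GC ≃* GC) (THC : Subgroup HC) (η : GC ≃* GsC) (j : HC →* GsC)
    (reg : Set GC) (regH : Set HC) (γ' : HC) (γ : GC) : Prop :=
  OriginatesVia σH' σ THC η j reg γ' γ → γ' ∈ regH

/-- **Proposition 2.4.5 (ii)** (p. 393): «`γ″ ∈ H` also originates from `γ` via `(T, η)` if and only if `γ″ = (γ′)^{ω′}`,
`ω′ ∈ 𝔄_H(T′)`» — `𝔄_H(T′)` = ★ `scriptA σH' T′C`, `T′C` the complex torus of `H` containing `γ′` (a datum of the regular `γ′`),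
`(γ′)^{ω′} = ω′γ′ω′⁻¹`.  PREDICATE on print's data. [cite: Shelstad1982, Proposition 2.4.5 (ii) (p. 393)] -/
def Shelstad1982_2_4_5_ii (σH' : HC ≃* HC) (σ : GC ≃* GC) (THC : Subgroup HC) (η : GC ≃* GsC) (j : HC →* GsC)
    (reg : Set GC) (T'C : Subgroup HC) (γ' γ'' : HC) (γ : GC) : Prop :=
  OriginatesVia σH' σ THC η j reg γ' γ → γ' ∈ T'C →
    (OriginatesVia σH' σ THC η j reg γ'' γ ↔ ∃ ω' ∈ scriptA σH' T'C, γ'' = ω' * γ' * ω'⁻¹)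

/-- **Proposition 2.4.5 (iii)** (p. 393): «`γ′` originates from `γ̄` via `(T, η)` if and only if `γ̄ = γ^ω`, with
`ω ∈ Ω₀(G, T) ∩ Ω^{(κ)}(G, T)`. As usual, `Ω₀(G, T) = {ω ∈ Ω(G, T) : ωσ = σω}`; `Ω^{(κ)}(G, T)` was defined in Proposition 2.3.1.» —
the Weyl elements as maps `w : GC → GC` on `TC` realized by some `n` (★ `Realizes`), the set `Ω0κ` = «`Ω₀ ∩ Ω^{(κ)}`» a parameter
(its lattice definition is `OmegaKappa` + commuting with `σ`).  PREDICATE on print's data. [cite: Shelstad1982, Proposition 2.4.5 (iii) (p. 393)] -/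
def Shelstad1982_2_4_5_iii (σH' : HC ≃* HC) (σ : GC ≃* GC) (THC : Subgroup HC) (η : GC ≃* GsC) (j : HC →* GsC)
    (reg : Set GC) (TC : Subgroup GC) (Ω0κ : Set (GC → GC)) (γ' : HC) (γ γbar : GC) : Prop :=
  OriginatesVia σH' σ THC η j reg γ' γ → γ ∈ TC →
    (OriginatesVia σH' σ THC η j reg γ' γbar ↔ ∃ w ∈ Ω0κ, ∃ n : GC, Realizes TC w n ∧ γbar = n * γ * n⁻¹)

end GroupOriginates

/-! ## (3.1.5) The compatibility conditions on `ε`, `Λ` (p. 395) — spelled out for the sibling's `TransferSetting.IsCoherent` -/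

section Coherence

variable {G : Type u} [Group G] {Root : Type u₁} {RootStar : Type u₂}

/-- **`R(ω_H)`** (p. 395): «`R(ω_H) = {α ∈ Δ(G, T) : σ_Tα = −α, κ(α∨) ≠ 1, α̃ = ηα ∈ Δ(B*, T*), ω_Hα̃ ∈ −Δ(B*, T*)}`» — the roots of
`(G, T)` (finset `roots`) that are imaginary (`IsImag`), have `κ(α∨) ≠ 1` (`¬ kappaOne α`), whose transport `α̃ = ηα` (`toStar`) is
`B*`-positive and is made negative by `ω_H ∈ Ω(H, T_H)` (acting on `Δ(G*, T*)` through (2.2.3), `wH`). [cite: Shelstad1982, §3.1 (3.1.5) (p. 395)] -/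
def RSet (roots : Finset Root) (IsImag kappaOne : Root → Prop) [DecidablePred IsImag] [DecidablePred kappaOne]
    (toStar : Root → RootStar) (IsPosStar : RootStar → Prop) [DecidablePred IsPosStar] (wH : RootStar → RootStar) : Finset Root :=
  roots.filter fun α => IsImag α ∧ ¬ kappaOne α ∧ IsPosStar (toStar α) ∧ ¬ IsPosStar (wH (toStar α))

/-- **(3.1.5)** (p. 395): «Hence for `{Δ_(T,η)}` to be a family of transfer factors we must have
`ε(T, ω_H∘η∘ω⁻¹) = κ(ω)(−1)^{[R(ω_H)]} ε(T, η)` and `Λ_(T, ω_H∘η∘ω⁻¹) = ((Σ_{α∈R(ω_H)} α)⁻¹ Λ_(T,η))^ω` for all `ω_H ∈ Ω(H, T_H)` and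
`ω ∈ 𝔄(T)`» — for ONE pair `p = (T, η)` and its transform `p′ = (T^ω, ω_H∘η∘ω⁻¹)` (both given; the action `(ω_H, ω) · p` is the
sibling's pair bookkeeping): `ε`, `Λ` the sign and the character of (3.1.3) as functions of the pair, `κω = κ(ω)`, `R = R(ω_H)`
(`RSet`), `rootVal α γ = α(γ)`, `(Σ_{α∈R} α)(γ) = Π_{α∈R} α(γ)` (characters written additively in print), `χ^ω(γ^ω) = χ(γ)` with
`γ^ω = conjω γ`, read for `γ ∈ T`; `[R(ω_H)]` = the cardinality of `R(ω_H)`.  PREDICATE on print's data (a necessary condition print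
derives from Prop. 3.1.2, then imposes). [cite: Shelstad1982, §3.1 (3.1.5) (p. 395)] -/
def Shelstad1982_3_1_5 {Pair : Type w} (T : Subgroup G) (p p' : Pair) (ε : Pair → ℤˣ) (Λ : Pair → G → ℂ) (κω : ℂ)
    (R : Finset Root) (rootVal : Root → G → ℂ) (conjω : G → G) : Prop :=
  ((ε p' : ℤ) : ℂ) = κω * (-1 : ℂ) ^ R.card * ((ε p : ℤ) : ℂ) ∧
    ∀ γ ∈ T, Λ p' (conjω γ) = (∏ α ∈ R, rootVal α γ)⁻¹ * Λ p γ

end Coherence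

/-! ## (3.2) Standard position, framework of Cartan subgroups (pp. 395–396) -/

section Framework

variable {GC : Type u} [Group GC] {GsC : Type u₁} [Group GsC] {HC : Type u₂} [Group HC] {Y : Type v} [AddCommGroup Y]

/-- **Standard position (3.2.1)–(3.2.2)** (p. 395): «We now insist that `𝔰_H = (s_H, ᴸH)` have the following properties: (3.2.1)
`ᴸT⁰_H = ᴸT⁰` and (3.2.2) `σ_H` acts on `ᴸT⁰` as `σ_N`», `σ_N` «the (canonical) transfer of `σ_{T_N}` to `ᴸT⁰`» for the fixed
standard Cartan subgroup `T_N` of `G*` from which `T_H` originates — on the lattice `Y = X*(ᴸT⁰)` (where (3.2.1) is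
`EndoscopicPair.TH_eq`): `σ_H∣_{ᴸT⁰} = σ_N`. [cite: Shelstad1982, §3.2 (3.2.1)–(3.2.2) (p. 395)] -/
def IsStandardPosition (σHY σN : (Y ≃ₗ[ℤ] Y)) : Prop := σHY = σN

/-- **A framework of Cartan subgroups around `T_N`** (p. 395), the DATA: indices `n = 0, …, N` (`Fin (N+1)`, `T′_N = T_H`);
standard Cartan subgroups `T′_n` of `H` (complex tori `THn n ≤ HC`) «representing all conjugacy classes», standard Cartan subgroups
`T_n` of `G*` (`Tn n ≤ GsC`) «such that `T′_n` originates from `T_n`», elements `m′_n ∈ M′_n`, `m_n ∈ M_n` with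
`ad m′_n : T′_n → T_H = T*`, `ad m_n : T_n → T*` (over `ℂ`); and, for the `n` with `T′_n` originating in `G` (`inG n`), `T_n^G ≤ GC`,
`x_n ∈ G*` with `ψ_n = ad x_n ∘ ψ : T_n^G → T_n` over `ℝ`.  The derived maps `i_n`, `η_n^G`, `i_n^G` are the definitions below; the
CONDITIONS print imposes are `Framework.IsFramework`. [cite: Shelstad1982, §3.2 (p. 395)] -/
structure Framework (GC : Type u) [Group GC] (GsC : Type u₁) [Group GsC] (HC : Type u₂) [Group HC] (N : ℕ) where
  /-- `T′_n`, complex points -/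
  THn : Fin (N + 1) → Subgroup HC
  /-- `T_n`, complex points -/
  Tn : Fin (N + 1) → Subgroup GsC
  /-- `m′_n` -/
  m' : Fin (N + 1) → HC
  /-- `m_n` -/
  m : Fin (N + 1) → GsC
  /-- «if `T′_n` originates in `G`» -/
  inG : Fin (N + 1) → Prop
  /-- `T_n^G`, complex points -/
  TGn : Fin (N + 1) → Subgroup GC
  /-- `x_n`, `ψ_n = ad x_n ∘ ψ` -/
  x : Fin (N + 1) → GsC

variable {N : ℕ}

/-- `i_n = ad m_n⁻¹ ∘ ad m′_n : T′_n → T_n` over `ℝ` (p. 395), on complex points through the identification `j : T_H(ℂ) ≅ T*(ℂ)` of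
(2.2.3): `t′ ↦ m_n⁻¹ j(m′_n t′ m′_n⁻¹) m_n`. [cite: Shelstad1982, §3.2 (p. 395)] -/
def Framework.iN (F : Framework GC GsC HC N) (j : HC →* GsC) (n : Fin (N + 1)) : HC → GsC :=
  fun t => (F.m n)⁻¹ * j (F.m' n * t * (F.m' n)⁻¹) * F.m n

/-- `η_n^G = ad m_n ∘ ψ_n = ad m_n ∘ ad x_n ∘ ψ : T_n^G → T*` (p. 395) — the p.d. `pd ψ x_n m_n`. [cite: Shelstad1982, §3.2 (p. 395)] -/
def Framework.etaG (F : Framework GC GsC HC N) (ψ : GC ≃* GsC) (n : Fin (N + 1)) : GC ≃* GsC := pd ψ (F.x n) (F.m n)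

/-- `i_n^G : T′_n → T_n^G` (p. 395: «`i_n^G = ψ_n ∘ i_n`», with `ψ_n : T_n^G → T_n`; as `i_n` lands in `T_n` the composite is
`ψ_n⁻¹ ∘ i_n` — the types force the inverse, which is what the display means): `t′ ↦ ψ_n⁻¹(i_n(t′))`, `ψ_n = ad x_n ∘ ψ`.
[cite: Shelstad1982, §3.2 (p. 395)] -/
def Framework.iG (F : Framework GC GsC HC N) (ψ : GC ≃* GsC) (j : HC →* GsC) (n : Fin (N + 1)) : HC → GC :=
  fun t => (ψ.trans (MulAut.conj (F.x n))).symm (F.iN j n t)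

/-- **The conditions on a framework** (p. 395): every `T′_n`, `T_n` (and `T_n^G`) is conjugation-stable («defined over `ℝ`»),
`T′_N = T_H`, `IsStandardH (T′_n)`, `IsStandard (T_n)` (parameters), every conjugacy class of Cartan subgroups of `H` is represented
(`∀ T′` stable, `∃ n`, `T′` is `H`-conjugate to `T′_n`), `ad m′_n(T′_n) = T_H`, `ad m_n(T_n) = T*`, `i_n` is defined over `ℝ` on
`T′_n` and maps it onto `T_n`; `S(T_n) ⊆ S(T_N)` and «`T_n = T_p` if `T_n` is conjugate to `T_p`» (`splitPart` a parameter); for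
`inG n`: `ψ_n = ad x_n ∘ ψ` is defined over `ℝ` on `T_n^G` and maps it onto `T_n`. [cite: Shelstad1982, §3.2 (p. 395)] -/
def Framework.IsFramework {Gd : Type w} [Group Gd] (F : Framework GC GsC HC N) (E : EndoscopicPair GsC HC Gd) (σ : GC ≃* GC)
    (ψ : GC ≃* GsC) (IsStandardH : Subgroup HC → Prop) (IsStandard : Subgroup GsC → Prop)
    (splitPart : Subgroup GsC → Subgroup GsC) : Prop :=
  F.THn (Fin.last N) = E.THC ∧
  (∀ n, (∀ t ∈ F.THn n, E.σH' t ∈ F.THn n) ∧ (∀ t ∈ F.Tn n, E.σs t ∈ F.Tn n) ∧ IsStandardH (F.THn n) ∧ IsStandard (F.Tn n) ∧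
    (F.THn n).map (MulAut.conj (F.m' n)).toMonoidHom = E.THC ∧ (F.Tn n).map (MulAut.conj (F.m n)).toMonoidHom = E.TsC ∧
    IsDefinedOverOn E.σH' E.σs (F.iN E.j n) (F.THn n) ∧ (F.iN E.j n) '' (F.THn n : Set HC) = F.Tn n ∧
    splitPart (F.Tn n) ≤ splitPart (F.Tn (Fin.last N))) ∧
  (∀ T' : Subgroup HC, (∀ t ∈ T', E.σH' t ∈ T') → IsStandardH T' →
    ∃ n, ∃ h ∈ realPoints E.σH', T'.map (MulAut.conj h).toMonoidHom = F.THn n) ∧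
  (∀ n p, (∃ g ∈ realPoints E.σs, (F.Tn n).map (MulAut.conj g).toMonoidHom = F.Tn p) → F.Tn n = F.Tn p) ∧
  ∀ n, F.inG n → (∀ t ∈ F.TGn n, σ t ∈ F.TGn n) ∧ IsDefinedOverOn σ E.σs (psiX ψ (F.x n)) (F.TGn n) ∧
    (F.TGn n).map (psiX ψ (F.x n)) = F.Tn n

/-- **Proposition 3.2.3** (p. 396): «Suppose that `γ′ ∈ H` originates from `γ ∈ G_reg` via `(T, η)`. Then `T = (T_n^G)^ω`, and
`η = ω_H ∘ η_n^G ∘ ω⁻¹`, for some `n`, `ω_H ∈ Ω(H, T_H)` and `ω ∈ 𝔄(T^{G_n})`» — `ω_H` acting on `T*` through (2.2.3) as a map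
`wH : GsC → GsC` from the set `ΩH` (parameter), `ω ∈ 𝔄(T_n^G)` (★ `scriptA`), the identity of maps read on `T`.  PREDICATE on print's
data. [cite: Shelstad1982, Proposition 3.2.3 (p. 396)] -/
def Shelstad1982_3_2_3 (F : Framework GC GsC HC N) (σH' : HC ≃* HC) (σ : GC ≃* GC) (THC : Subgroup HC) (ψ : GC ≃* GsC)
    (j : HC →* GsC) (reg : Set GC) (ΩH : Set (GsC → GsC)) (TC : Subgroup GC) (η : GC ≃* GsC) (γ' : HC) (γ : GC) : Prop :=
  OriginatesVia σH' σ THC η j reg γ' γ → γ ∈ TC →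
    ∃ n, F.inG n ∧ ∃ wH ∈ ΩH, ∃ ω ∈ scriptA σ (F.TGn n),
      TC = (F.TGn n).map (MulAut.conj ω).toMonoidHom ∧ ∀ t ∈ TC, η t = wH (F.etaG ψ n (ω⁻¹ * t * ω))

/-- **The matching identity behind (3.1.1) ∕ Proposition 3.2.4 for ONE torus** (pp. 393, 396): `Φ^{(T′,1)}_{f′}(γ′) = Δ(γ)·Φ^{(T,κ)}_f(γ)`
whenever `γ′ = i⁻¹(γ)`, `γ ∈ G_reg ∩ T` — the orbital integrals entering as FUNCTIONALS `ΦH f′ : HC → ℂ`, `ΦG f : GC → ℂ` (their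
definition with measures `dt′, dh`, `dt, dg` is block A's ∕ [15]; here parameters), `i : HC → GC` the map `i_n^G`.  This local predicate
serves P3.2.4 and P3.4.2 only; the FAMILY notion «set of `(G,H)`-orbital-integral transfer factors» (3.1.1) is the sibling file's.
[cite: Shelstad1982, §3.1 (3.1.1) (p. 393), Proposition 3.2.4 (p. 396)] -/
def MatchesVia (i : HC → GC) (T'C : Subgroup HC) (reg : Set GC) (Δ : GC → ℂ) (ΦH : HC → ℂ) (ΦG : GC → ℂ) : Prop :=
  ∀ γ' ∈ T'C, i γ' ∈ reg → ΦH γ' = Δ (i γ') * ΦG (i γ')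

/-- **Proposition 3.2.4** (p. 396): «`{Δ_(T,η)}`, satisfying (3.1.3) and (3.1.5), is an admissible family of `(G, H)`-orbital-integral-
transfer factors if and only if for each `f ∈ 𝒞(G)` there exists `f′ ∈ 𝒞(H)` such that
`Φ^{(T′_n,1)}_{f′}(γ′, dt′, dh) = (−1)^{q(G,H)} ε_n^G Λ_n^G(γ) ′Δ_n^G(γ) Φ_f^{(T_n^G, κ_n^G)}(γ, dt, dg)` if `γ ∈ G_reg` and
`γ′ = (i_n^G)⁻¹(γ)`, and `Φ^{(T′,1)}_{f′}( , ) ≡ 0` if `T′` does not originate in `G`.»  Dress: Schwartz spaces as sets `CG`, `CH` of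
functions, orbital integrals as functionals `ΦG n f`, `ΦH T′ f′` (per torus), `ε_n^G = eps n`, `Λ_n^G = Λ n`, `′Δ_n^G = Δ' n` as given
functions (block A ∕ (3.3.3)), `IsAdmissibleFamily` = the left-hand side (the sibling file's notion, a parameter), `origH T′` = «`T′`
originates in `G`».  PREDICATE on print's data. [cite: Shelstad1982, Proposition 3.2.4 (p. 396)] -/
def Shelstad1982_3_2_4 (F : Framework GC GsC HC N) (ψ : GC ≃* GsC) (j : HC →* GsC) (reg : Set GC) (CG : Set (GC → ℂ))
    (CH : Set (HC → ℂ)) (ΦG : Fin (N + 1) → (GC → ℂ) → GC → ℂ) (ΦH : Subgroup HC → (HC → ℂ) → HC → ℂ) (q : ℕ)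
    (eps : Fin (N + 1) → ℂ) (Λ Δ' : Fin (N + 1) → GC → ℂ) (origH : Subgroup HC → Prop) (IsAdmissibleFamily : Prop) : Prop :=
  IsAdmissibleFamily ↔ ∀ f ∈ CG, ∃ f' ∈ CH,
    (∀ n, F.inG n → MatchesVia (F.iG ψ j n) (F.THn n) reg
      (fun γ => (-1 : ℂ) ^ q * eps n * Λ n γ * Δ' n γ) (ΦH (F.THn n) f') (ΦG n f)) ∧
    ∀ T' : Subgroup HC, ¬ origH T' → ∀ γ' : HC, ΦH T' f' γ' = 0

end Framework

/-! ## (3.3) Admissible embeddings and correction characters (pp. 396–397) -/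

section Correction

variable {GC : Type u} [Group GC] {V : Type v} [AddCommGroup V] [Module ℂ V]

/-- `ι_n` = «one-half the sum of the coroots for `(ᴸB⁰ ∩ ᴸM⁰_n, ᴸT⁰)`» and `ι′_n` likewise for `ᴸ(M′_n)⁰` (p. 396), in
`V = X_*(ᴸT⁰) ⊗ ℂ`: `½ Σ_{α∨ ∈ P} α∨` for the finite set `P` of positive coroots in question. [cite: Shelstad1982, §3.3 (p. 396)] -/
def halfSumCoroots (P : Finset V) : V := (2⁻¹ : ℂ) • ∑ a ∈ P, a

/-- The parameter of the correction character, `μ* + ι_n − ι′_n` (p. 397, (3.3.3)), for an admissible embedding `ξ = ξ(μ*, λ*)` of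
`ᴸH` in `ᴸG` ((3.3.1)–(3.3.2): «`ξ∣_{ᴸH⁰ × 1}` is the inclusion», «`ξ(1 × w) = ξ₀(w) × w`», to which [16] attaches `(μ*, λ*)` by
`λ∨(ξ₀(z × 1)) = z^{⟨μ*,λ∨⟩} z̄^{⟨σ_Hμ*,λ∨⟩}`, `λ∨(ξ₀(1 × σ)) = e^{2πi⟨λ*,λ∨⟩}`). [cite: Shelstad1982, §3.3 (3.3.1)–(3.3.3) (pp. 396–397)] -/
def correctionParam (muStar : V) (Pn P'n : Finset V) : V := muStar + halfSumCoroots Pn - halfSumCoroots P'n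

/-- **(3.3.3) the correction characters `Λ_n^G = χ^G(μ* + ι_n − ι′_n, λ*)`** (p. 397), `χ^G(μ, λ)` the quasicharacter on `T_n^G` of
[16, Sect. 4.1] attached to a pair `(μ, λ)` — a PARAMETER `chiOf` (defined in [16], not in this paper); «Then `{Λ_n^G}` is a “set of
correction characters” in the sense of [16] (this is the main result of [16])». [cite: Shelstad1982, §3.3 (3.3.3) (p. 397)] -/
def correctionCharacter (chiOf : V → V → GC → ℂ) (muStar lamStar : V) (Pn P'n : Finset V) : GC → ℂ :=
  chiOf (correctionParam muStar Pn P'n) lamStar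

/-- «We say that `ξ` is of unitary type if each `χ(μ* + ι_n − ι′_n, λ*)` is a character (that is, is unitary)» (p. 397): all values on
the Cartan subgroups `T_n` (real points `Tn n`) have absolute value `1`. [cite: Shelstad1982, §3.3 (p. 397)] -/
def IsUnitaryType {ι : Type w} (Tn : ι → Set GC) (Λ : ι → GC → ℂ) : Prop := ∀ n, ∀ t ∈ Tn n, ‖Λ n t‖ = 1

/-- p. 396: «`½(μ* − σ_nμ*) + ι_n − ι′_n ≡ (λ* + σ_nλ*) (mod X_*(ᴸT⁰))` and `μ* − σ_nμ* ∈ X_*(ᴸT⁰)`, `n = 0, 1, …, N`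
(Theorem 3.4.1 of [16])», `X_*(ᴸT⁰) ⊂ V` the lattice (`L`), `σ_n` acting on `V` — the two conditions making
`χ(μ* + ι_n − ι′_n, λ*)` «a well-defined quasicharacter» on `T_n`.  PREDICATE on print's data (a theorem of [16] for admissible `ξ`).
[cite: Shelstad1982, §3.3 (p. 396)] -/
def Shelstad1982_3_3_congruence (L : AddSubgroup V) (σn : V →ₗ[ℂ] V) (muStar lamStar : V) (Pn P'n : Finset V) : Prop :=
  ((2⁻¹ : ℂ) • (muStar - σn muStar) + halfSumCoroots Pn - halfSumCoroots P'n) - (lamStar + σn lamStar) ∈ L ∧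
    muStar - σn muStar ∈ L

end Correction

/-! ## (3.4) Endoscopic groups for the Levi components of a parabolic subgroup (pp. 397–398) -/

section Levi

variable {Gd : Type u} [Group Gd] {GsC : Type u₁} [Group GsC] {Y : Type v} [AddCommGroup Y]

/-- `ᴸ(M′)⁰ = ᴸH⁰ ∩ ᴸM⁰` (p. 397: «Then (3.4.1) implies that `ᴸ(M′)⁰` is invariant under `σ_H`. Set `ᴸM′ = ᴸ(M′)⁰ ⋊ W`»).
[cite: Shelstad1982, §3.4 (p. 397)] -/
def leviDual (H0 M0 : Subgroup Gd) : Subgroup Gd := H0 ⊓ M0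

/-- p. 397: «Then (3.4.1) implies that `ᴸ(M′)⁰` is invariant under `σ_H`» — PREDICATE on print's data ((3.4.1) = `InScriptT` with
`Ω(ᴸM⁰ ∩ ᴸH⁰, ᴸT⁰)`; `σH` the automorphism `ρ(w)`, `w ↦ σ`). [cite: Shelstad1982, §3.4 (p. 397)] -/
def Shelstad1982_3_4_leviInvariant (ΩMH : Subgroup ((Y ≃ₗ[ℤ] Y))) (σHY τ : (Y ≃ₗ[ℤ] Y)) (σH : Gd ≃* Gd) (H0 M0 : Subgroup Gd) : Prop :=
  InScriptT ΩMH σHY τ → (leviDual H0 M0).map σH.toMonoidHom = leviDual H0 M0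

/-- «`(U, η_U)` is subordinate to `M` if `U ⊂ M` and `η_U` is of the form `ad m ∘ η`, `m ∈ M*`» (p. 397), on complex points
(`UC`, `MC` in `GC`; `MsC = M*`; the identity of maps read on `U`). [cite: Shelstad1982, §3.4 (p. 397)] -/
def IsSubordinate {GC : Type u₂} [Group GC] (UC MC : Subgroup GC) (MsC : Subgroup GsC) (ηU η : GC ≃* GsC) : Prop :=
  UC ≤ MC ∧ ∃ m ∈ MsC, ∀ u ∈ UC, ηU u = m * η u * m⁻¹

/-- `{μ∨ ∈ X_*(T_sc) : Nm μ∨ = μ∨ + σ_Tμ∨ = 0}` (p. 398; also the numerator of `ℰ(T)`, p. 392) for the involution `τ = σ_T` — the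
explicit-involution twin of ★ `normZeroLattice`. [cite: Shelstad1982, §3.4 (p. 398)] -/
def normZero (τ : Y ≃ₗ[ℤ] Y) (Ysc : AddSubgroup Y) : AddSubgroup Ysc where
  carrier := {y | (y : Y) + τ y = 0}
  add_mem' := by
    intro a b ha hb
    simp only [Set.mem_setOf_eq, AddSubgroup.coe_add, map_add] at ha hb ⊢
    rw [add_add_add_comm, ha, hb, add_zero]
  zero_mem' := by simp
  neg_mem' := by
    intro a ha
    simp only [Set.mem_setOf_eq, AddSubgroup.coe_neg, map_neg] at ha ⊢
    rw [← neg_add, ha, neg_zero]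

/-- **`κ_M`**, «the restriction of `κ` to `{μ∨ ∈ X_*(T_sc) : Nm μ∨ = μ∨ + σ_Tμ∨ = 0}`» (p. 398: «then `κ_M` is the quasicharacter
attached to `(U, η_U)` as an element of `𝒯_{M′}(M)`»). [cite: Shelstad1982, §3.4 (p. 398)] -/
def kappaM (τ : Y ≃ₗ[ℤ] Y) (Ysc : AddSubgroup Y) (κ : Ysc →+ Additive ℂˣ) : normZero τ Ysc →+ Additive ℂˣ :=
  κ.comp (normZero τ Ysc).subtype

end Levi

section LeviAnalysis

variable {G₀ : Type u} [Group G₀]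

/-- `f̄(x) = ∫_K f(kxk⁻¹) dk` (p. 398), `K` «a suitably chosen maximal compact subgroup of `G`» with the fixed measure `dk`.
[cite: Shelstad1982, §3.4 (p. 398)] -/
def fBar (K : Subgroup G₀) [MeasurableSpace K] (μK : Measure K) (f : G₀ → ℂ) (x : G₀) : ℂ :=
  ∫ k : K, f ((k : G₀) * x * (k : G₀)⁻¹) ∂μK

/-- **`f_M(m) = (δ_P(m))^{1/2} ∫_N f̄(mn) dn`** (p. 398), `N` the unipotent radical of `P`, `δ_P` the modular function of `P`, `dn` fixed
(«note that `f_M` is the function “`f^{(P)}`” of [3]»). [cite: Shelstad1982, §3.4 (p. 398)] -/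
def constantTerm (K N : Subgroup G₀) [MeasurableSpace K] [MeasurableSpace N] (μK : Measure K) (μN : Measure N) (δP : G₀ → ℝ)
    (f : G₀ → ℂ) (m : G₀) : ℂ :=
  (Real.sqrt (δP m) : ℂ) * ∫ n : N, fBar K μK f (m * (n : G₀)) ∂μN

/-- `|α(γ)^{1/2} − α(γ)^{−1/2}|` (p. 398) for the root value `a = α(γ) ∈ ℂ^×`, written without a choice of square root:
`|1 − a| / |a|^{1/2}` (the two agree for either branch). [cite: Shelstad1982, §3.4 (p. 398)] -/
def absRootFactor (a : ℂ) : ℝ := ‖1 - a‖ / Real.sqrt ‖a‖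

/-- **The descent formula** (p. 398): «Then `Φ_f^{(U,κ)}(γ, du, dg) = Π_{α>0, σα≠−α} |α(γ)^{1/2} − α(γ)^{−1/2}|⁻¹ Φ_{f_M}^{(U,κ_M)}(γ, du, dm)`
for `γ ∈ U ∩ M_reg` and `(U, η_U)` subordinate to `M`» (measures `dg = dk dn dm`), and the same on `H`: «`Φ^{(U′,1)}_{f′}(γ′, du′, dh) =
Π_{α′>0, σα′≠−α′} |…|⁻¹ Φ^{(U′,1)}_{f′_{M′}}(γ′, du′, dm′)`».  Dress: the `κ`-orbital integrals as functionals `ΦG`, `ΦM`, the root set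
`{α > 0 : σα ≠ −α}` as a finset `R` of functions `G₀ → ℂ`, `fM` = `constantTerm …` (or any realisation).  PREDICATE on print's data
(Harish-Chandra's descent, [3]). [cite: Shelstad1982, §3.4 (p. 398)] -/
def Shelstad1982_3_4_descent (UMreg : Set G₀) (R : Finset (G₀ → ℂ)) (ΦG ΦM : (G₀ → ℂ) → G₀ → ℂ) (fM : (G₀ → ℂ) → G₀ → ℂ)
    (f : G₀ → ℂ) : Prop :=
  ∀ γ ∈ UMreg, ΦG f γ = (∏ α ∈ R, (absRootFactor (α γ))⁻¹ : ℝ) * ΦM (fM f) γ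

/-- `ε_M(U, η_U) = (−1)^{q(G,H) − q(M,M′)} ε(U, η_U)` (p. 398) (`q`, `qM` the two integers, `ε = ±1` the sign of (3.1.3)).
[cite: Shelstad1982, §3.4 (p. 398)] -/
def epsM (q qM : ℤ) (ε : ℤ) : ℤ := (-1) ^ (q - qM).natAbs * ε

/-- **`Δ^M_(U,η_U) = ε_M(U,η_U) Λ_(U,η_U) ′Δ_(U,η_U) / Π_{α>0, σα≠−α, κ(α∨)≠1} |α^{1/2} − α^{−1/2}|`** (p. 398), as a function on `U`:
`Λ`, `Δ′` the correction character and the factor `′Δ` of (3.1.3) (given functions), `R'` the finset of roots `{α > 0 : σα ≠ −α,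
κ(α∨) ≠ 1}` as functions. [cite: Shelstad1982, §3.4 (p. 398)] -/
def deltaM (εM : ℤ) (Λ Δ' : G₀ → ℂ) (R' : Finset (G₀ → ℂ)) (γ : G₀) : ℂ :=
  (εM : ℂ) * Λ γ * Δ' γ / (∏ α ∈ R', absRootFactor (α γ) : ℝ)

/-- **Proposition 3.4.2** (p. 398): «If `{Δ_( , )}` is a set of `(G, H)`-orbital-integral-transfer factors then `{Δ^M_(U,η_U) : (U, η_U)`
is subordinate to `M}` defines a set of `(M, M′)`-orbital-integral-transfer factors. Moreover, if `f′ ∈ 𝒞(H)` corresponds to `f ∈ 𝒞(G)`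
relative to `{Δ_( , )}` then `f′_{M′} ∈ 𝒞(M′)` corresponds to `f_M ∈ 𝒞(M)` relative to `{Δ^M_( , )}`» («the following result is
immediate» from the descent formula).  Dress: the two family notions are the sibling file's (parameters `IsTransferFamilyGH`,
`IsTransferFamilyMM'`); «corresponds» for ONE subordinate pair `(U, η_U)` with Cartan `U′ ⊂ M′` is `MatchesVia` (orbital integrals as
functionals on `G`, `H`, `M`, `M′`; `fM`, `f′M′` the constant terms).  PREDICATE on print's data. [cite: Shelstad1982, Proposition 3.4.2 (p. 398)] -/
def Shelstad1982_3_4_2 {H₀ : Type u₁} [Group H₀] (IsTransferFamilyGH IsTransferFamilyMM' : Prop) (i : H₀ → G₀) (U'C : Subgroup H₀)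
    (reg regM : Set G₀) (Δ ΔM : G₀ → ℂ) (ΦG ΦM : (G₀ → ℂ) → G₀ → ℂ) (ΦH ΦM' : (H₀ → ℂ) → H₀ → ℂ)
    (fM : (G₀ → ℂ) → G₀ → ℂ) (f'M' : (H₀ → ℂ) → H₀ → ℂ) (f : G₀ → ℂ) (f' : H₀ → ℂ) : Prop :=
  IsTransferFamilyGH → IsTransferFamilyMM' ∧
    (MatchesVia i U'C reg Δ (ΦH f') (ΦG f) → MatchesVia i U'C regM ΔM (ΦM' (f'M' f')) (ΦM (fM f)))

end LeviAnalysis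

/-! ## Discharges: proofs of the CLOSED items (statements above untouched) -/

section Discharges

/-- Proof of `Shelstad1982_2_1_equiv_refl` (p. 390): take `g = 1`. [cite: Shelstad1982, §2.1 (p. 390)] -/
theorem Shelstad1982_2_1_equiv_refl_holds : Shelstad1982_2_1_equiv_refl.{u} := by
  intro Gd _ σd S
  refine ⟨1, ?_, ?_, ?_, ?_, ?_⟩
  · ext x; simp
  · ext x; simp
  · ext x; simp
  · have key : ∀ φ : Gd ≃* Gd, ((MulAut.conj (1 : Gd)).symm.trans φ).trans (MulAut.conj (1 : Gd)) = φ := by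
      intro φ; ext x
      simp only [MulEquiv.trans_apply, MulAut.conj_symm_apply, MulAut.conj_apply, inv_one, one_mul, mul_one]
    ext φ
    simp only [Set.mem_setOf_eq, key]
    constructor
    · intro h; exact ⟨φ, h, rfl⟩
    · rintro ⟨φ₁, h₁, rfl⟩; exact h₁
  · intro x _
    simp only [inv_one, one_mul, mul_one]

/-- Proof of `Shelstad1982_2_3_liftsCoset` (p. 391): two invariant lifts differ by an invariant character vanishing on `Ysc`.
[cite: Shelstad1982, §2.3 (p. 391)] -/
theorem Shelstad1982_2_3_liftsCoset_holds : Shelstad1982_2_3_liftsCoset.{v} := by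
  intro Y _ τ Ysc κ s hs s'
  obtain ⟨hs1, hs2⟩ := hs
  constructor
  · rintro ⟨h1, h2⟩
    refine ⟨fun y => ?_, fun y => ?_⟩
    · simp [h1 y, hs1 y]
    · simp [h2 y, hs2 y]
  · rintro ⟨h1, h2⟩
    refine ⟨fun y => ?_, fun y => ?_⟩
    · have := h1 y
      simp only [AddMonoidHom.sub_apply, hs1 y] at this
      exact sub_left_injective this
    · have := h2 y
      simp only [AddMonoidHom.sub_apply, hs2 y, sub_eq_zero] at this
      exact this

/-- Proof of `Shelstad1982_2_4_kappaOfSH` (p. 392): an invariant character kills `τμ − μ`. [cite: Shelstad1982, §2.4 (p. 392)] -/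
theorem Shelstad1982_2_4_kappaOfSH_holds : Shelstad1982_2_4_kappaOfSH.{v} := by
  intro Y _ τ Ysc sH hinv y hy
  obtain ⟨μ, hμ⟩ := mem_cobdyLattice.mp hy
  simp only [AddMonoidHom.coe_comp, AddSubgroup.coe_subtype, Function.comp_apply]
  rw [← hμ, map_sub, hinv μ, sub_self]

/-- Proof of `Shelstad1982_2_4_2_star` (pp. 392–393): invariance and `τα∨ = −α∨` give `s(α∨) = s(−α∨) = −s(α∨)`, so `2·s(α∨) = 0`
(`α∨(s) = ±1`); and `s′(α∨) = 0 ↔ s_H(α∨) = 0` (same root sets) with both values of order `≤ 2` in `ℂ^×` forces equality, the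
non-trivial element of order `2` being `−1`. [cite: Shelstad1982, Lemma 2.4.2, proof (∗) (pp. 392–393)] -/
theorem Shelstad1982_2_4_2_star_holds : Shelstad1982_2_4_2_star.{v} := by
  intro Y _ τ Rv s' sH hs' hsH hroots a ha hτa
  have two : ∀ s : Y →+ Additive ℂˣ, (∀ y : Y, s (τ y) = s y) → (2 : ℕ) • s a = 0 := by
    intro s hs
    have h := hs a
    rw [hτa, map_neg] at h
    rw [two_nsmul]
    nth_rewrite 2 [← h]
    exact add_neg_cancel (s a)
  have h2' := two s' hs'
  have h2H := two sH hsH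
  refine ⟨?_, h2'⟩
  -- an element `x` of `Additive ℂˣ` with `2 • x = 0` is `0` or `ofMul (-1)`
  have key : ∀ x : Additive ℂˣ, (2 : ℕ) • x = 0 → x = 0 ∨ x = Additive.ofMul (-1) := by
    intro x hx
    have hx' : (Additive.toMul x) ^ 2 = 1 := by
      rw [← toMul_nsmul, hx]; rfl
    have hu : ((Additive.toMul x : ℂˣ) : ℂ) * ((Additive.toMul x : ℂˣ) : ℂ) = 1 := by
      rw [← Units.val_mul, ← pow_two, hx', Units.val_one]
    rcases mul_self_eq_one_iff.mp hu with h | h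
    · left
      have : Additive.toMul x = 1 := Units.ext h
      simpa using congrArg Additive.ofMul this
    · right
      have : Additive.toMul x = -1 := Units.ext (by simpa using h)
      simpa using congrArg Additive.ofMul this
  have iff0 : s' a = 0 ↔ sH a = 0 := by
    have := Set.ext_iff.mp hroots a
    simp only [Langlands1983.GroupesEndoscopiques.racinesH, Set.mem_setOf_eq] at this
    constructor
    · intro h; exact ((this.mp ⟨ha, h⟩)).2
    · intro h; exact ((this.mpr ⟨ha, h⟩)).2
  have hne : Additive.ofMul (-1 : ℂˣ) ≠ 0 := by
    rw [Ne, ofMul_eq_zero]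
    intro h
    have h' := congrArg (fun u : ℂˣ => (u : ℂ)) h
    norm_num at h'
  rcases key _ h2' with h1 | h1 <;> rcases key _ h2H with h2 | h2
  · rw [h1, h2]
  · exact absurd (iff0.mp h1) (by rw [h2]; exact hne)
  · exact absurd (iff0.mpr h2) (by rw [h1]; exact hne)
  · rw [h1, h2]

/-- `ℂ^×` is `ℤ`-rootable: `x ↦ x ^ n` is onto for `n ≠ 0` (`ℂ` algebraically closed), in additive notation (the same folklore step as in
★ `Langlands1983/GroupesEndoscopiques`, whose copy is private there). [folklore] -/
private theorem zsmul_surjective_additive_units {n : ℤ} (hn : n ≠ 0) :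
    Function.Surjective (fun a : Additive ℂˣ => n • a) := by
  intro x
  have hk : n.natAbs ≠ 0 := Int.natAbs_ne_zero.mpr hn
  have hx0 : ((Additive.toMul x : ℂˣ) : ℂ) ≠ 0 := (Additive.toMul x).ne_zero
  obtain ⟨z, hz⟩ := IsAlgClosed.exists_pow_nat_eq ((Additive.toMul x : ℂˣ) : ℂ) (Nat.pos_of_ne_zero hk)
  have hz0 : z ≠ 0 := by
    rintro rfl
    rw [zero_pow hk] at hz
    exact hx0 hz.symm
  set r : ℂˣ := Units.mk0 z hz0 with hr
  have hrk : r ^ n.natAbs = Additive.toMul x := by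
    ext
    rw [Units.val_pow_eq_pow_val, hr, Units.val_mk0, hz]
  rcases Int.natAbs_eq n with h | h
  · refine ⟨Additive.ofMul r, ?_⟩
    show n • Additive.ofMul r = x
    rw [← ofMul_zpow, h, zpow_natCast, hrk, ofMul_toMul]
  · refine ⟨Additive.ofMul r⁻¹, ?_⟩
    show n • Additive.ofMul r⁻¹ = x
    rw [← ofMul_zpow, h, inv_zpow', neg_neg, zpow_natCast, hrk, ofMul_toMul]

/-- Proof of `Shelstad1982_2_3_liftExists` (p. 391): pass to `Q = Y/{τμ − μ}`; `κ` descends to the image of `Ysc` in `Q` because it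
kills `Ysc ∩ {τμ − μ}`; extend there because `ℂ^×` is divisible, hence an injective `ℤ`-module (Mathlib `Module.Baer.of_divisible`,
`extension_property_addMonoidHom` — the road of ★ `Langlands1983_II_4_kappaExtends_holds`), and pull back; the pull-back is
`τ`-invariant by construction. [cite: Shelstad1982, §2.3 (p. 391)] -/
theorem Shelstad1982_2_3_liftExists_holds : Shelstad1982_2_3_liftExists.{v} := by
  intro Y _ τ Ysc κ hκ
  classical
  set A : AddSubgroup Y := cobdyLattice τ with hA
  let π : Y →+ Y ⧸ A := QuotientAddGroup.mk' A
  let πsc : Ysc →+ Ysc.map π := π.addSubgroupMap Ysc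
  have hsurj : Function.Surjective πsc := π.addSubgroupMap_surjective Ysc
  have hker : πsc.ker ≤ κ.ker := by
    intro y hy
    rw [AddMonoidHom.mem_ker] at hy ⊢
    apply hκ
    have : π (y : Y) = 0 := by
      have := congrArg Subtype.val hy
      simpa [πsc] using this
    have : (y : Y) ∈ A := by
      rw [QuotientAddGroup.mk'_apply, QuotientAddGroup.eq_zero_iff] at this
      exact this
    simpa [hA] using this
  let κ' : Ysc.map π →+ Additive ℂˣ := πsc.liftOfSurjective hsurj ⟨κ, hker⟩
  have hκ' : ∀ y : Ysc, κ' (πsc y) = κ y := fun y =>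
    πsc.liftOfRightInverse_comp_apply (Function.surjInv hsurj) (Function.rightInverse_surjInv hsurj) ⟨κ, hker⟩ y
  let inst : DivisibleBy (Additive ℂˣ) ℤ :=
    divisibleByOfSMulRightSurj (Additive ℂˣ) ℤ fun hn => zsmul_surjective_additive_units hn
  have hB : Module.Baer ℤ (Additive ℂˣ) := @Module.Baer.of_divisible (Additive ℂˣ) _ inst
  obtain ⟨s₀, hs₀⟩ := hB.extension_property_addMonoidHom (Ysc.map π).subtype Subtype.val_injective κ'
  refine ⟨s₀.comp π, fun y => ?_, fun y => ?_⟩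
  · simp only [AddMonoidHom.coe_comp, Function.comp_apply]
    have hmem : τ y - y ∈ A := by rw [hA, mem_cobdyLattice]; exact ⟨y, rfl⟩
    have : π (τ y) = π y := by
      rw [QuotientAddGroup.mk'_apply, QuotientAddGroup.mk'_apply, QuotientAddGroup.eq_iff_sub_mem]
      exact hmem
    rw [this]
  · simp only [AddMonoidHom.coe_comp, Function.comp_apply]
    have hy : π (y : Y) ∈ Ysc.map π := ⟨y, y.2, rfl⟩
    have e1 : s₀ (π (y : Y)) = κ' ⟨π (y : Y), hy⟩ := by rw [← hs₀]; rfl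
    have e2 : (⟨π (y : Y), hy⟩ : Ysc.map π) = πsc y := Subtype.ext rfl
    rw [e1, e2, hκ']

end Discharges

end Literature.NumberTheory.Automorphic.Shelstad1982.EndoscopicData

end
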